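import Literature.Barriers.AnomalousDissipation.ShearFlowViscositySelectionLimitSteps
import Literature.Barriers.AnomalousDissipation.ShearFlowViscositySelectionTransport
import Literature.Analysis.FluidPDE.LerayHopfTimeSliceTorus
import Literature.Barriers.AnomalousDissipation.ShearFlowViscositySelectionLemma4
import HarnessLib

/-!
# Bardos–Titi–Wiedemann 2012, Theorem 5: the limit equation — discharge of the named fact
`BardosTitiWiedemann2012_thm5_limitEq`

Theorem-only companion to `ShearFlowViscositySelectionLimitSteps.lean` (the named fact) using
`ShearFlowViscositySelectionTransport.lean` / `ShearFlowViscositySelectionLemma4.lean`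
(Lemma 4: existence by the explicit shear transport, uniqueness by duality). Source:
C. Bardos, E. S. Titi, E. Wiedemann, C. R. Math. 350 (2012) 757–760, proof of Thm. 5, p. 759:
"the `x₁`- and `x₂`-components [pass] to the limit … by linearity. The equation for `u₃` follows
from `u₁^ν u₃^ν ⇀* u₁u₃`, thanks to the strong convergence of `u₁^ν` … `ū₃` is a weak solution
of `∂ₜū₃ + u₁(x₂)∂ₓ₁ū₃ = 0` (6) … with `ū₃ ∈ L^∞L²` … by Lemma 4 … `ū₃ = u₃`."

## The argument formalised

* `shearField_weak_vertical` — testing the Navier–Stokes weak formulation of the shear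
  Leray–Hopf solution `(a_j, 0, c_j)` with the divergence-free vertical fields `φ(t,(x₁,x₂)) e₃`
  (`φ` a test on `T² × [0,T)`) gives the advection–diffusion weak form of `c_j` against planar
  lifts: `∫∫ c_j(∂ₜφ + a_j∂₁φ + ν_jΔ) + ∫ v₃φ(0) = 0`.
* `limit_weak_vertical` — term-by-term limit: `∂ₜ`-term by weak convergence, product term by
  "strong × weak" (`‖a_j - v₁‖_{L²_{t,x}} → 0`, uniform `L²_{t,x}` bound of `c_j` from the energy
  inequality, Cauchy–Schwarz), viscous term `O(ν_j)`; the limit `W` satisfies (6) against planar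
  lifts.
* `ae_eq_liftFibreAvg_of_weakLimit` — the weak limit of planar functions is planar: `W(t)`
  equals its fibre average `w̄(t,(x₁,x₂)) = ∫_T W(t,(x₁,x₂,s))ds` a.e.
* `isWeakScalarTransportOn_fibreAvg` — `w̄` is a weak solution of (6) on `T²` in the accepted
  class `Torus.IsWeakScalarTransportOn T 0 (shearVelocity v₁) v₃` (Fubini along the fibres,
  Jensen for the `L^∞L²` bound).
* `BardosTitiWiedemann2012_thm5_limitEq_holds` — Lemma 4 uniqueness
  (`ae_ae_eq_of_isWeakScalarTransportOn`) against the explicit solution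
  (`isWeakScalarTransportOn_shearTransport_of_measurable`), for a measurable representative of
  `v₁`, then back to `W` on `T³`.

After this file and its siblings, `BardosTitiWiedemann2012_thm5_holds` only awaits the
weak–strong uniqueness fact `BardosTitiWiedemann2012_thm5_uniqueness`
(`BardosTitiWiedemann2012_thm5_of_facts`, `BardosTitiWiedemann2012_thm5_subseqLimit_of_facts`).

## References

* C. Bardos, E. S. Titi, E. Wiedemann, C. R. Math. Acad. Sci. Paris 350 (2012) 757–760, Thm. 5
  and its proof, Lemma 4 (`BardosTitiWiedemann2012`).
* J. C. Robinson, J. L. Rodrigo, W. Sadowski, *The Three-Dimensional Navier–Stokes Equations*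
  (2016), Def. 3.7 (weak formulation with divergence-free tests) (`RobinsonRodrigoSadowski2016`).
-/

open MeasureTheory Set Filter Topology Function UnitAddTorus
open scoped ENNReal NNReal InnerProductSpace RealInnerProductSpace ContDiff

noncomputable section

namespace Literature.Barriers.AnomalousDissipation

/-- The flat three-torus (local notation). -/
local notation "𝕋³" => UnitAddTorus (Fin 3)
/-- The flat two-torus (local notation). -/
local notation "𝕋²" => UnitAddTorus (Fin 2)

/-! ## Splitting `T³ = T² × T` along the third coordinate -/

section Split

/-- The point of `T³` with planar part `y ∈ T²` and third coordinate `s`: `Fin.insertNth 2 s`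
composed with the identification `j ↦ y j` of the first two coordinates, written out. [folklore] -/
theorem insertNth_two_eq (s : UnitAddCircle) (y : 𝕋²) :
    (MeasurableEquiv.piFinSuccAbove (fun _ : Fin 3 => UnitAddCircle) 2).symm (s, y) = ![y 0, y 1, s] := by
  funext i
  fin_cases i <;> rfl

/-- The planar part of the split is `x ↦ (x₁, x₂)` and the fibre coordinate is `x₃`. [folklore] -/
theorem piFinSuccAbove_two_apply (x : 𝕋³) :
    MeasurableEquiv.piFinSuccAbove (fun _ : Fin 3 => UnitAddCircle) 2 x = (x 2, ![x 0, x 1]) := by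
  refine Prod.ext rfl ?_
  funext j
  fin_cases j <;> rfl

/-- **Fubini along the third coordinate**: for an integrable `F : T³ → ℝ`,
`∫_{T³} F = ∫_{T²} ∫_T F(y₁, y₂, s) ds dy`. [folklore] -/
theorem integral_eq_integral_integral_fibre {F : 𝕋³ → ℝ} (hF : Integrable F volume) :
    ∫ x, F x = ∫ y : 𝕋², ∫ s : UnitAddCircle, F ![y 0, y 1, s] := by
  set e := MeasurableEquiv.piFinSuccAbove (fun _ : Fin 3 => UnitAddCircle) 2 with he
  have hmp : MeasurePreserving e.symm
      ((volume : Measure UnitAddCircle).prod (Measure.pi fun _ : Fin 2 => (volume : Measure UnitAddCircle)))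
      (Measure.pi fun _ : Fin 3 => (volume : Measure UnitAddCircle)) :=
    (measurePreserving_piFinSuccAbove (fun _ : Fin 3 => (volume : Measure UnitAddCircle)) 2).symm
  have h1 : ∫ x, F x = ∫ p, F (e.symm p) ∂((volume : Measure UnitAddCircle).prod
      (Measure.pi fun _ : Fin 2 => (volume : Measure UnitAddCircle))) := by
    rw [MeasureTheory.volume_pi]
    exact (hmp.integral_comp' F).symm
  have hF' : Integrable (fun p : UnitAddCircle × 𝕋² => F (e.symm p))
      ((volume : Measure UnitAddCircle).prod (Measure.pi fun _ : Fin 2 => (volume : Measure UnitAddCircle))) := by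
    rw [MeasureTheory.volume_pi] at hF
    exact hmp.integrable_comp_emb e.symm.measurableEmbedding |>.2 hF
  rw [h1, integral_prod _ hF', integral_integral_swap hF']
  simp_rw [he, insertNth_two_eq]
  rfl

/-- **Pairing a planar function with a field on `T³`** reduces to `T²` against the fibre
average: `∫_{T³} f(x₁,x₂) G(x) dx = ∫_{T²} f(y) (∫_T G(y,s) ds) dy`. [folklore] -/
theorem integral_planar_mul {f : 𝕋² → ℝ} {G : 𝕋³ → ℝ}
    (hint : Integrable (fun x : 𝕋³ => f ![x 0, x 1] * G x) volume) :
    ∫ x : 𝕋³, f ![x 0, x 1] * G x = ∫ y : 𝕋², f y * ∫ s : UnitAddCircle, G ![y 0, y 1, s] := by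
  rw [integral_eq_integral_integral_fibre hint]
  refine integral_congr_ae (Eventually.of_forall fun y => ?_)
  simp only [Matrix.cons_val_zero, Matrix.cons_val_one]
  rw [vec2_eta, ← integral_const_mul]

end Split

/-! ## Vector calculus on the torus: `θ • e` for a constant vector -/

section VecHelpers

variable {d : Type*} [Fintype d]

/-- `Torus.fderiv` of `θ • e` for a constant vector `e`: `D(θ e)(x)[w] = (Dθ(x)[w]) e`. [folklore] -/
theorem fderiv_smul_const_apply {F : Type*} [NormedAddCommGroup F] [NormedSpace ℝ F]
    {θ : UnitAddTorus d → ℝ} (hθ : Literature.Analysis.FunctionSpaces.Torus.IsContDiff 1 θ) (e : F)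
    (x : UnitAddTorus d) (w : EuclideanSpace ℝ d) :
    Literature.Analysis.FunctionSpaces.Torus.fderiv (fun y => θ y • e) x w =
      (Literature.Analysis.FunctionSpaces.Torus.fderiv θ x w) • e := by
  unfold Literature.Analysis.FunctionSpaces.Torus.fderiv
  rw [show Literature.Analysis.FunctionSpaces.Torus.liftAt (fun y => θ y • e) x =
      fun v => Literature.Analysis.FunctionSpaces.Torus.liftAt θ x v • e from rfl,
    fderiv_smul_const ((hθ.liftAt x).differentiable one_ne_zero).differentiableAt]
  rfl

/-- `Torus.laplacian` of `θ • e` for a constant vector `e` and smooth `θ`: `Δ(θ e) = (Δθ) e`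
(Mathlib's `ContDiffAt.laplacian_CLM_comp_left` on the re-centred lift). [folklore] -/
theorem laplacian_smul_const_apply {F : Type*} [NormedAddCommGroup F] [InnerProductSpace ℝ F]
    {θ : UnitAddTorus d → ℝ} (hθ : Literature.Analysis.FunctionSpaces.Torus.IsSmooth θ) (e : F)
    (x : UnitAddTorus d) :
    Literature.Analysis.FunctionSpaces.Torus.laplacian (fun y => θ y • e) x =
      (Literature.Analysis.FunctionSpaces.Torus.laplacian θ x) • e := by
  unfold Literature.Analysis.FunctionSpaces.Torus.laplacian
  have h : Literature.Analysis.FunctionSpaces.Torus.liftAt (fun y => θ y • e) x =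
      (ContinuousLinearMap.toSpanSingleton ℝ e) ∘ Literature.Analysis.FunctionSpaces.Torus.liftAt θ x := by
    funext v
    simp [Literature.Analysis.FunctionSpaces.Torus.liftAt_apply, ContinuousLinearMap.toSpanSingleton_apply]
  have h2 : ContDiffAt ℝ 2 (Literature.Analysis.FunctionSpaces.Torus.liftAt θ x) 0 :=
    ((hθ.isContDiff (n := 2) (WithTop.coe_le_coe.mpr le_top)).liftAt x).contDiffAt
  rw [h, h2.laplacian_CLM_comp_left]
  simp [ContinuousLinearMap.toSpanSingleton_apply]

/-- `Torus.fderiv θ x w = ⟪w, ∇θ(x)⟫` (both are the Fréchet derivative of the re-centred lift at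
`0`, the gradient through the Riesz map). [folklore] -/
theorem fderiv_apply_eq_inner_gradient {θ : UnitAddTorus d → ℝ}
    (x : UnitAddTorus d) (w : EuclideanSpace ℝ d) :
    Literature.Analysis.FunctionSpaces.Torus.fderiv θ x w =
      ⟪w, Literature.Analysis.FunctionSpaces.Torus.gradient θ x⟫ := by
  unfold Literature.Analysis.FunctionSpaces.Torus.fderiv Literature.Analysis.FunctionSpaces.Torus.gradient
  rw [real_inner_comm, gradient, InnerProductSpace.toDual_symm_apply]


end VecHelpers

/-! ## Planar lifts of test functions and the vertical test fields `Φ e₃` -/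

section PlanarLift

/-- Velocity values (local notation). -/
local notation "E³" => EuclideanSpace ℝ (Fin 3)

variable {T : ℝ} {φ : ℝ → 𝕋² → ℝ}

/-- The planar coordinate map `ℝ³ → ℝ²`, `Y ↦ (Y₁, Y₂)`, is smooth. [folklore] -/
theorem contDiff_planar : ContDiff ℝ ∞ fun Y : E³ => (!₂[Y 0, Y 1] : EuclideanSpace ℝ (Fin 2)) := by
  rw [contDiff_piLp]
  intro i
  fin_cases i
  · exact (EuclideanSpace.proj (𝕜 := ℝ) (0 : Fin 3)).contDiff
  · exact (EuclideanSpace.proj (𝕜 := ℝ) (1 : Fin 3)).contDiff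

/-- The planar part of a projected point: `((proj Y)₁, (proj Y)₂) = proj (Y₁, Y₂)`. [folklore] -/
theorem planar_proj (Y : E³) :
    (![Literature.Analysis.FunctionSpaces.Torus.proj Y 0, Literature.Analysis.FunctionSpaces.Torus.proj Y 1] : 𝕋²) =
      Literature.Analysis.FunctionSpaces.Torus.proj (!₂[Y 0, Y 1] : EuclideanSpace ℝ (Fin 2)) := by
  funext j
  fin_cases j <;> simp [Literature.Analysis.FunctionSpaces.Torus.proj_apply]

/-- **The planar lift of a space–time test on `T²` is a space–time test on `T³`**:
`Φ(t,x) = φ(t,(x₁,x₂))`. [folklore] -/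
theorem isSpaceTimeTest_planarLift (hφ : Literature.Analysis.FunctionSpaces.Torus.IsSpaceTimeTest T φ) :
    Literature.Analysis.FunctionSpaces.Torus.IsSpaceTimeTest T (fun t (x : 𝕋³) => φ t ![x 0, x 1]) := by
  obtain ⟨hs, T', hT'T, hT'⟩ := hφ
  refine ⟨?_, T', hT'T, fun t ht => ?_⟩
  · have h : Literature.Analysis.FunctionSpaces.Torus.stLift (fun t (x : 𝕋³) => φ t ![x 0, x 1]) =
        Literature.Analysis.FunctionSpaces.Torus.stLift φ ∘ fun p : ℝ × E³ => (p.1, (!₂[p.2 0, p.2 1] : EuclideanSpace ℝ (Fin 2))) := by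
      funext p
      obtain ⟨t, Y⟩ := p
      show φ t ![Literature.Analysis.FunctionSpaces.Torus.proj Y 0, Literature.Analysis.FunctionSpaces.Torus.proj Y 1] =
        φ t (Literature.Analysis.FunctionSpaces.Torus.proj (!₂[Y 0, Y 1] : EuclideanSpace ℝ (Fin 2)))
      rw [planar_proj]
    rw [h]
    exact hs.comp (contDiff_fst.prodMk (contDiff_planar.comp contDiff_snd))
  · funext x
    simp [hT' t ht]

/-- The planar lift does not depend on `x₃`. [folklore] -/
theorem planarLift_add_single_two (φ : ℝ → 𝕋² → ℝ) (t : ℝ) (s : UnitAddCircle) (x : 𝕋³) :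
    φ t ![(x + Pi.single (2 : Fin 3) s : 𝕋³) 0, (x + Pi.single (2 : Fin 3) s : 𝕋³) 1] = φ t ![x 0, x 1] := by
  simp

/-- `∂₃` of the planar lift vanishes. [folklore] -/
theorem partialDeriv_two_planarLift (φ : ℝ → 𝕋² → ℝ) (t : ℝ) (x : 𝕋³) :
    Literature.Analysis.FunctionSpaces.Torus.partialDeriv 2 (fun x : 𝕋³ => φ t ![x 0, x 1]) x = 0 := by
  unfold Literature.Analysis.FunctionSpaces.Torus.partialDeriv Literature.Analysis.FunctionSpaces.Torus.lineDeriv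
  have h : (fun s : ℝ => φ t ![(x + Literature.Analysis.FunctionSpaces.Torus.proj
      (s • EuclideanSpace.single (2 : Fin 3) (1 : ℝ))) 0,
      (x + Literature.Analysis.FunctionSpaces.Torus.proj (s • EuclideanSpace.single (2 : Fin 3) (1 : ℝ))) 1]) =
      fun _ => φ t ![x 0, x 1] := by
    funext s
    simp [Literature.Analysis.FunctionSpaces.Torus.proj_apply]
  rw [h, deriv_const]

/-- `∂₁` of the planar lift is the lift of `∂₁`. [folklore] -/
theorem partialDeriv_zero_planarLift (φ : ℝ → 𝕋² → ℝ) (t : ℝ) (x : 𝕋³) :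
    Literature.Analysis.FunctionSpaces.Torus.partialDeriv 0 (fun x : 𝕋³ => φ t ![x 0, x 1]) x =
      Literature.Analysis.FunctionSpaces.Torus.partialDeriv 0 (φ t) ![x 0, x 1] := by
  unfold Literature.Analysis.FunctionSpaces.Torus.partialDeriv Literature.Analysis.FunctionSpaces.Torus.lineDeriv
  congr 1
  funext s
  show φ t ![(x + Literature.Analysis.FunctionSpaces.Torus.proj (s • EuclideanSpace.single (0 : Fin 3) (1 : ℝ))) 0,
      (x + Literature.Analysis.FunctionSpaces.Torus.proj (s • EuclideanSpace.single (0 : Fin 3) (1 : ℝ))) 1] =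
    φ t ((![x 0, x 1] : 𝕋²) + Literature.Analysis.FunctionSpaces.Torus.proj (s • EuclideanSpace.single (0 : Fin 2) (1 : ℝ)))
  congr 1
  funext j
  fin_cases j <;> simp [Literature.Analysis.FunctionSpaces.Torus.proj_apply]

/-- `∂ₜ` of the planar lift is the lift of `∂ₜ`. [folklore] -/
theorem timeDeriv_planarLift (φ : ℝ → 𝕋² → ℝ) (t : ℝ) (x : 𝕋³) :
    Literature.Analysis.FunctionSpaces.Torus.timeDeriv (fun t (x : 𝕋³) => φ t ![x 0, x 1]) t x =
      Literature.Analysis.FunctionSpaces.Torus.timeDeriv φ t ![x 0, x 1] := rfl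

/-- **The vertical test field `Φ e₃` is divergence free** (`div (Φ e₃) = ∂₃Φ = 0`). [folklore] -/
theorem isDivFreeTest_vertical (φ : ℝ → 𝕋² → ℝ) :
    Literature.Analysis.FunctionSpaces.Torus.IsDivFreeTest (fun t (x : 𝕋³) =>
      φ t ![x 0, x 1] • EuclideanSpace.single (2 : Fin 3) (1 : ℝ)) := by
  intro t x
  unfold Literature.Analysis.FunctionSpaces.Torus.divergence
  have h : ∀ i : Fin 3, (fun y : 𝕋³ => (φ t ![y 0, y 1] • EuclideanSpace.single (2 : Fin 3) (1 : ℝ)) i) =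
      fun y => (EuclideanSpace.single (2 : Fin 3) (1 : ℝ) i) • φ t ![y 0, y 1] := by
    intro i; funext y; simp [mul_comm]
  simp_rw [h, Literature.Analysis.FluidPDE.Torus.partialDeriv_const_smul_apply, smul_eq_mul]
  rw [Finset.sum_eq_single (2 : Fin 3) (fun i _ hi => by simp [hi]) (fun h => (h (Finset.mem_univ _)).elim),
    partialDeriv_two_planarLift]
  simp

/-- **The vertical test field `Φ e₃` is a space–time test field** on `T³ × [0,T)`. [folklore] -/
theorem isSpaceTimeTest_vertical (hφ : Literature.Analysis.FunctionSpaces.Torus.IsSpaceTimeTest T φ) :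
    Literature.Analysis.FunctionSpaces.Torus.IsSpaceTimeTest T (fun t (x : 𝕋³) =>
      φ t ![x 0, x 1] • EuclideanSpace.single (2 : Fin 3) (1 : ℝ)) := by
  obtain ⟨hs, T', hT'T, hT'⟩ := isSpaceTimeTest_planarLift hφ
  refine ⟨?_, T', hT'T, fun t ht => ?_⟩
  · show ContDiff ℝ ∞ fun p : ℝ × E³ =>
      Literature.Analysis.FunctionSpaces.Torus.stLift (fun t (x : 𝕋³) => φ t ![x 0, x 1]) p •
        EuclideanSpace.single (2 : Fin 3) (1 : ℝ)
    exact hs.smul contDiff_const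
  · funext x
    have := congrFun (hT' t ht) x
    simp only [Pi.zero_apply] at this
    simp [this]

end PlanarLift

/-! ## The third component of a shear Leray–Hopf solution: the advection–diffusion weak form,
tested with planar lifts -/

section ThirdComponent

/-- Velocity values (local notation). -/
local notation "E³" => EuclideanSpace ℝ (Fin 3)

variable {T ν : ℝ} {v₁ : UnitAddCircle → ℝ} {v₃ : 𝕋² → ℝ} {a : ℝ → UnitAddCircle → ℝ} {c : ℝ → 𝕋² → ℝ}

/-- Pairing a shear-form vector with a vertical vector: `⟪(a,0,c), r e₃⟫ = r c`. [folklore] -/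
theorem inner_shearField_vertical (a : ℝ → UnitAddCircle → ℝ) (c : ℝ → 𝕋² → ℝ) (t : ℝ) (x : 𝕋³) (r : ℝ) :
    ⟪shearField a c t x, r • EuclideanSpace.single (2 : Fin 3) (1 : ℝ)⟫ = r * c t ![x 0, x 1] := by
  rw [real_inner_smul_right, EuclideanSpace.inner_single_right]
  simp [shearField]

/-- **The advection–diffusion weak form of the third component, against planar lifts.** Let
`u = (a(t,x₂), 0, c(t,x₁,x₂))` be a Leray–Hopf solution on `T³ × [0,T)` with viscosity `ν` and
shear datum `(v₁(x₂), 0, v₃(x₁,x₂))`, and `φ` a space–time test on `T² × [0,T)`. Testing the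
Navier–Stokes weak formulation with the divergence-free vertical field `φ(t,(x₁,x₂)) e₃` gives
`∫₀ᵀ∫_{T³} c (∂ₜφ + a ∂₁φ + ν Δ) + ∫_{T³} v₃ φ(0) = 0` (planar functions evaluated at `(x₁,x₂)`;
the convective term is `c a ∂₁φ` because `u₂ = 0` and `∂₃` of a planar lift vanishes)
(Bardos–Titi–Wiedemann 2012, proof of Thm. 5: the second of the "two-and-half Navier–Stokes
equations", in weak form). [cite: BardosTitiWiedemann2012, Thm. 5, proof] -/
theorem shearField_weak_vertical
    (hU : Literature.Analysis.FluidPDE.Torus.IsLerayHopfOn T ν 0 (shearData v₁ v₃) (shearField a c))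
    {φ : ℝ → 𝕋² → ℝ} (hφ : Literature.Analysis.FunctionSpaces.Torus.IsSpaceTimeTest T φ) :
    (∫ t in Ioo 0 T, ∫ x : 𝕋³, (c t ![x 0, x 1] * Literature.Analysis.FunctionSpaces.Torus.timeDeriv φ t ![x 0, x 1] +
        c t ![x 0, x 1] * (a t (x 1) * Literature.Analysis.FunctionSpaces.Torus.partialDeriv 0 (φ t) ![x 0, x 1]) +
        ν * (c t ![x 0, x 1] * Literature.Analysis.FunctionSpaces.Torus.laplacian (fun x : 𝕋³ => φ t ![x 0, x 1]) x))) +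
      ∫ x : 𝕋³, v₃ ![x 0, x 1] * φ 0 ![x 0, x 1] = 0 := by
  set e₂ : E³ := EuclideanSpace.single (2 : Fin 3) (1 : ℝ) with he₂
  set Φ : ℝ → 𝕋³ → ℝ := fun t x => φ t ![x 0, x 1] with hΦ
  have hΦtest := isSpaceTimeTest_planarLift hφ
  have hw := hU.weak.2.2.2 (fun t x => Φ t x • e₂) (isSpaceTimeTest_vertical hφ) (isDivFreeTest_vertical φ)
  -- pointwise identities
  have hsm : ∀ t, Literature.Analysis.FunctionSpaces.Torus.IsSmooth (Φ t) := fun t => hΦtest.isSmooth_slice t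
  have htd : ∀ t x, Literature.Analysis.FunctionSpaces.Torus.timeDeriv (fun t x => Φ t x • e₂) t x =
      (Literature.Analysis.FunctionSpaces.Torus.timeDeriv φ t ![x 0, x 1]) • e₂ := by
    intro t x
    simp only [Literature.Analysis.FunctionSpaces.Torus.timeDeriv, hΦ]
    have hd : DifferentiableAt ℝ (fun τ => φ τ ![x 0, x 1]) t := by
      have h1 : Differentiable ℝ (Literature.Analysis.FunctionSpaces.Torus.stLift Φ) := hΦtest.1.differentiable (by simp)
      obtain ⟨Y, hY⟩ := Literature.Analysis.FunctionSpaces.Torus.proj_surjective x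
      have h2 : (fun τ => φ τ ![x 0, x 1]) = fun τ => Literature.Analysis.FunctionSpaces.Torus.stLift Φ (τ, Y) := by
        funext τ; rw [← hY]; rfl
      rw [h2]
      exact (h1.comp (differentiable_id.prodMk (differentiable_const _))) t
    exact deriv_smul_const hd e₂
  have hconv : ∀ t x, Literature.Analysis.FunctionSpaces.Torus.convect (shearField a c t) (fun x => Φ t x • e₂) x =
      (a t (x 1) * Literature.Analysis.FunctionSpaces.Torus.partialDeriv 0 (φ t) ![x 0, x 1]) • e₂ := by
    intro t x
    unfold Literature.Analysis.FunctionSpaces.Torus.convect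
    rw [fderiv_smul_const_apply ((hsm t).isContDiff (by simp)), fderiv_apply_eq_inner_gradient,
      Literature.Analysis.FunctionSpaces.Torus.inner_gradient_eq_sum_mul_partialDeriv ((hsm t).isContDiff (by simp)),
      Fin.sum_univ_three, hΦ, partialDeriv_two_planarLift, partialDeriv_zero_planarLift]
    simp [shearField]
  have hlap : ∀ t x, Literature.Analysis.FunctionSpaces.Torus.laplacian (fun x => Φ t x • e₂) x =
      (Literature.Analysis.FunctionSpaces.Torus.laplacian (Φ t) x) • e₂ := fun t x =>
    laplacian_smul_const_apply (hsm t) e₂ x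
  have hpt : ∀ t x, ⟪shearField a c t x, Literature.Analysis.FunctionSpaces.Torus.timeDeriv (fun t x => Φ t x • e₂) t x⟫ +
      ⟪shearField a c t x, Literature.Analysis.FunctionSpaces.Torus.convect (shearField a c t) (fun x => Φ t x • e₂) x⟫ +
      ν * ⟪shearField a c t x, Literature.Analysis.FunctionSpaces.Torus.laplacian (fun x => Φ t x • e₂) x⟫ +
      ⟪(0 : ℝ → 𝕋³ → E³) t x, Φ t x • e₂⟫ =
      c t ![x 0, x 1] * Literature.Analysis.FunctionSpaces.Torus.timeDeriv φ t ![x 0, x 1] +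
        c t ![x 0, x 1] * (a t (x 1) * Literature.Analysis.FunctionSpaces.Torus.partialDeriv 0 (φ t) ![x 0, x 1]) +
        ν * (c t ![x 0, x 1] * Literature.Analysis.FunctionSpaces.Torus.laplacian (fun x : 𝕋³ => φ t ![x 0, x 1]) x) := by
    intro t x
    rw [htd, hconv, hlap, inner_shearField_vertical, inner_shearField_vertical, inner_shearField_vertical,
      Pi.zero_apply, Pi.zero_apply, inner_zero_left, add_zero]
    ring
  have h0 : ∀ x : 𝕋³, ⟪shearData v₁ v₃ x, Φ 0 x • e₂⟫ = v₃ ![x 0, x 1] * φ 0 ![x 0, x 1] := by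
    intro x
    rw [real_inner_smul_right, EuclideanSpace.inner_single_right]
    simp [shearData, hΦ, mul_comm]
  simp_rw [hpt, h0] at hw
  exact hw

end ThirdComponent

/-! ## Cauchy–Schwarz on a general measure space (through `L²` inner products) -/

section CS

variable {α : Type*} {m : MeasurableSpace α} {μ : Measure α}

/-- `|∫ f g| ≤ ‖f‖_{L²} ‖g‖_{L²}` (toReal form) for `f, g ∈ L²(μ)`. [folklore] -/
theorem abs_integral_mul_le_of_memLp_two {f g : α → ℝ} (hf : MemLp f 2 μ) (hg : MemLp g 2 μ) :
    |∫ x, f x * g x ∂μ| ≤ (eLpNorm f 2 μ).toReal * (eLpNorm g 2 μ).toReal := by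
  have hinner : ⟪hf.toLp f, hg.toLp g⟫ = ∫ x, f x * g x ∂μ := by
    rw [L2.inner_def]
    refine integral_congr_ae ?_
    filter_upwards [hf.coeFn_toLp, hg.coeFn_toLp] with x hx hy
    rw [hx, hy, real_inner_comm, RCLike.inner_apply, conj_trivial]
  rw [← hinner, ← Lp.norm_toLp f hf, ← Lp.norm_toLp g hg]
  exact abs_real_inner_le_norm _ _

end CS

/-! ## Iterated integrals over `(0,T) × T³`: splitting sums
(the product form `∫ t in Ioo 0 T, ∫ x, f t x = ∫ z, f z.1 z.2 ∂(… .prod …)` is Mathlib's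
`MeasureTheory.integral_integral`) -/

section Iterated

variable {T : ℝ}

/-- Splitting an iterated integral of a sum of two integrable space–time functions. [folklore] -/
theorem setIntegral_integral_add₂ {f g : ℝ → 𝕋³ → ℝ}
    (hf : Integrable (uncurry f) (((volume : Measure ℝ).restrict (Ioo 0 T)).prod (volume : Measure 𝕋³)))
    (hg : Integrable (uncurry g) (((volume : Measure ℝ).restrict (Ioo 0 T)).prod (volume : Measure 𝕋³))) :
    ∫ t in Ioo 0 T, ∫ x, (f t x + g t x) = (∫ t in Ioo 0 T, ∫ x, f t x) + ∫ t in Ioo 0 T, ∫ x, g t x :=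
  integral_integral_add hf hg

/-- Splitting an iterated integral of a difference of two integrable space–time functions. [folklore] -/
theorem setIntegral_integral_sub₂ {f g : ℝ → 𝕋³ → ℝ}
    (hf : Integrable (uncurry f) (((volume : Measure ℝ).restrict (Ioo 0 T)).prod (volume : Measure 𝕋³)))
    (hg : Integrable (uncurry g) (((volume : Measure ℝ).restrict (Ioo 0 T)).prod (volume : Measure 𝕋³))) :
    ∫ t in Ioo 0 T, ∫ x, (f t x - g t x) = (∫ t in Ioo 0 T, ∫ x, f t x) - ∫ t in Ioo 0 T, ∫ x, g t x :=
  integral_integral_sub hf hg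

/-- Splitting an iterated integral of a sum of three integrable space–time functions. [folklore] -/
theorem setIntegral_integral_add₃ {f g h : ℝ → 𝕋³ → ℝ}
    (hf : Integrable (uncurry f) (((volume : Measure ℝ).restrict (Ioo 0 T)).prod (volume : Measure 𝕋³)))
    (hg : Integrable (uncurry g) (((volume : Measure ℝ).restrict (Ioo 0 T)).prod (volume : Measure 𝕋³)))
    (hh : Integrable (uncurry h) (((volume : Measure ℝ).restrict (Ioo 0 T)).prod (volume : Measure 𝕋³))) :
    ∫ t in Ioo 0 T, ∫ x, (f t x + g t x + h t x) =
      (∫ t in Ioo 0 T, ∫ x, f t x) + (∫ t in Ioo 0 T, ∫ x, g t x) + ∫ t in Ioo 0 T, ∫ x, h t x := by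
  have h1 : ∫ t in Ioo 0 T, ∫ x, (f t x + g t x + h t x) =
      (∫ t in Ioo 0 T, ∫ x, (f t x + g t x)) + ∫ t in Ioo 0 T, ∫ x, h t x :=
    integral_integral_add (hf.add hg) hh
  rw [h1, setIntegral_integral_add₂ hf hg]

end Iterated

/-! ## Passing to the limit in the third-component equation -/

section Limit

/-- Velocity values (local notation). -/
local notation "E³" => EuclideanSpace ℝ (Fin 3)

variable {T : ℝ} {v₁ : UnitAddCircle → ℝ} {v₃ : 𝕋² → ℝ}

/-- A space–time function on `(0,T) × T³` that is jointly continuous on `ℝ × T³` is bounded on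
`(0,T)` a.e. for the product measure and square integrable there. [folklore] -/
theorem memLp_two_uncurry_of_continuous {G : ℝ → 𝕋³ → ℝ}
    (hGs : Continuous (Literature.Analysis.FunctionSpaces.Torus.stLift G)) (T : ℝ) :
    ∃ K : ℝ, (∀ t ∈ Icc (0 : ℝ) T, ∀ x, ‖G t x‖ ≤ K) ∧
      AEStronglyMeasurable (Literature.Analysis.FunctionSpaces.Torus.stLift G) (volume.restrict (Ioo 0 T ×ˢ univ)) ∧
      ∫⁻ t in Ioo 0 T, ∫⁻ x, ‖G t x‖ₑ ^ 2 < ⊤ ∧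
      MemLp (uncurry G) 2 (((volume : Measure ℝ).restrict (Ioo 0 T)).prod (volume : Measure 𝕋³)) := by
  obtain ⟨K, hK⟩ := Literature.Analysis.FunctionSpaces.Torus.exists_norm_le_of_continuousOn_of_isCompact
    (S := univ) hGs.continuousOn isCompact_Icc (subset_univ (Icc (0 : ℝ) T))
  have hfin : ∫⁻ t in Ioo 0 T, ∫⁻ x, ‖G t x‖ₑ ^ 2 < ⊤ := by
    have hK0 : ∀ t ∈ Ioo (0 : ℝ) T, ∫⁻ x, ‖G t x‖ₑ ^ 2 ≤ ENNReal.ofReal (K ^ 2) := by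
      intro t ht
      calc ∫⁻ x, ‖G t x‖ₑ ^ 2 ≤ ∫⁻ _ : 𝕋³, ENNReal.ofReal (K ^ 2) := by
            refine lintegral_mono fun x => ?_
            rw [← ofReal_norm, ← ENNReal.ofReal_pow (norm_nonneg _)]
            exact ENNReal.ofReal_le_ofReal (pow_le_pow_left₀ (norm_nonneg _) (hK t (Ioo_subset_Icc_self ht) x) 2)
        _ = ENNReal.ofReal (K ^ 2) := by rw [lintegral_const, measure_univ, mul_one]
    calc ∫⁻ t in Ioo 0 T, ∫⁻ x, ‖G t x‖ₑ ^ 2 ≤ ∫⁻ _ in Ioo (0 : ℝ) T, ENNReal.ofReal (K ^ 2) :=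
          setLIntegral_mono measurable_const hK0
      _ < ⊤ := by
          rw [lintegral_const, Measure.restrict_apply_univ]
          exact ENNReal.mul_lt_top ENNReal.ofReal_lt_top measure_Ioo_lt_top
  have hm : AEStronglyMeasurable (Literature.Analysis.FunctionSpaces.Torus.stLift G) (volume.restrict (Ioo 0 T ×ˢ univ)) :=
    hGs.aestronglyMeasurable
  exact ⟨K, hK, hm, hfin, (Literature.Analysis.FunctionSpaces.Torus.memLp_two_uncurry
    (Literature.Analysis.FunctionSpaces.Torus.aestronglyMeasurable_uncurry_of_stLift_prod hm) hfin).1⟩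

/-- `V₁(x) = v₁(x₂)` times a bounded continuous space–time function is an admissible
`L²((0,T) × T³)` test with measurable lift. [folklore] -/
theorem admissible_shear_mul (hv₁ : MemLp v₁ 2 volume) {G : ℝ → 𝕋³ → ℝ}
    (hGs : Continuous (Literature.Analysis.FunctionSpaces.Torus.stLift G)) (T : ℝ) :
    AEStronglyMeasurable (Literature.Analysis.FunctionSpaces.Torus.stLift fun t (x : 𝕋³) => v₁ (x 1) * G t x)
        (volume.restrict (Ioo 0 T ×ˢ univ)) ∧
      ∫⁻ t in Ioo 0 T, ∫⁻ x : 𝕋³, ‖v₁ (x 1) * G t x‖ₑ ^ 2 < ⊤ ∧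
      MemLp (uncurry fun t (x : 𝕋³) => v₁ (x 1) * G t x) 2
        (((volume : Measure ℝ).restrict (Ioo 0 T)).prod (volume : Measure 𝕋³)) := by
  obtain ⟨K, hK, -, -, -⟩ := memLp_two_uncurry_of_continuous hGs T
  have hG : Continuous (uncurry G) := Literature.Analysis.FunctionSpaces.Torus.continuous_uncurry_of_continuous_stLift hGs
  have hV : MemLp (uncurry fun (_ : ℝ) (x : 𝕋³) => v₁ (x 1)) 2
      (((volume : Measure ℝ).restrict (Ioo 0 T)).prod (volume : Measure 𝕋³)) := memLp_uncurry_const_eval_one hv₁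
  have hae : ∀ᵐ z ∂(((volume : Measure ℝ).restrict (Ioo 0 T)).prod (volume : Measure 𝕋³)), z.1 ∈ Ioo 0 T :=
    (Measure.quasiMeasurePreserving_fst (μ := (volume : Measure ℝ).restrict (Ioo 0 T))
      (ν := (volume : Measure 𝕋³))).ae (ae_restrict_mem measurableSet_Ioo)
  have hGm : AEStronglyMeasurable (uncurry G) (((volume : Measure ℝ).restrict (Ioo 0 T)).prod (volume : Measure 𝕋³)) :=
    hG.aestronglyMeasurable
  have hprod : MemLp (uncurry fun t (x : 𝕋³) => v₁ (x 1) * G t x) 2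
      (((volume : Measure ℝ).restrict (Ioo 0 T)).prod (volume : Measure 𝕋³)) := by
    refine hV.of_le_mul (c := K) (hV.1.mul hGm) (hae.mono fun z hz => ?_)
    obtain ⟨t, x⟩ := z
    simp only [uncurry_apply_pair, norm_mul]
    rw [mul_comm]
    exact mul_le_mul_of_nonneg_right (hK t (Ioo_subset_Icc_self hz) x) (norm_nonneg _)
  have hm : AEStronglyMeasurable (Literature.Analysis.FunctionSpaces.Torus.stLift fun t (x : 𝕋³) => v₁ (x 1) * G t x)
      (volume.restrict (Ioo 0 T ×ˢ univ)) :=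
    Literature.Analysis.FunctionSpaces.Torus.aestronglyMeasurable_stLift_of_uncurry (S := Ioo 0 T) hprod.1
  have hfin : ∫⁻ t in Ioo 0 T, ∫⁻ x : 𝕋³, ‖v₁ (x 1) * G t x‖ₑ ^ 2 < ⊤ := by
    have h1 : ∫⁻ z, ‖uncurry (fun t (x : 𝕋³) => v₁ (x 1) * G t x) z‖ₑ ^ 2
        ∂(((volume : Measure ℝ).restrict (Ioo 0 T)).prod (volume : Measure 𝕋³)) =
        ∫⁻ t in Ioo 0 T, ∫⁻ x : 𝕋³, ‖v₁ (x 1) * G t x‖ₑ ^ 2 :=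
      lintegral_prod _ (hprod.1.aemeasurable.enorm.pow_const 2)
    rw [← h1, ← Literature.Analysis.FunctionSpaces.eLpNorm_two_pow_two_eq_lintegral]
    exact ENNReal.pow_lt_top hprod.eLpNorm_lt_top
  exact ⟨hm, hfin, hprod⟩


/-- **The limit equation (6) of Bardos–Titi–Wiedemann 2012, proof of Thm. 5, against planar
lifts.** Under the hypotheses of `BardosTitiWiedemann2012_thm5_limitEq` — Leray–Hopf solutions
`(a_j, 0, c_j)` with shear datum and viscosities `ν_j → 0`, first components converging to `v₁`
in `L²((0,T)×T³)`, third components converging weakly in `L²((0,T)×T³)` to `W` — the limit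
satisfies, for every space–time test `φ` on `T² × [0,T)`,
`∫₀ᵀ∫_{T³} W (∂ₜφ + v₁(x₂)∂₁φ)(t,(x₁,x₂)) + ∫_{T³} v₃ φ(0) = 0`: pass to the limit term by term
in `shearField_weak_vertical` ("the equation for `u₃` follows from `u₁^ν u₃^ν ⇀* u₁u₃`, thanks
to the strong convergence of `u₁^ν` to `u₁`", op. cit.; the viscous term is `O(ν_j)`). [cite: BardosTitiWiedemann2012, Thm. 5, proof] -/
theorem limit_weak_vertical (hv₁ : MemLp v₁ 2 volume) (hv₃ : MemLp v₃ 2 volume)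
    {ν : ℕ → ℝ} (hν : ∀ j, 0 < ν j) (hν₀ : Tendsto ν atTop (𝓝 0))
    {a : ℕ → ℝ → UnitAddCircle → ℝ} {c : ℕ → ℝ → 𝕋² → ℝ}
    (hU : ∀ j, Literature.Analysis.FluidPDE.Torus.IsLerayHopfOn T (ν j) 0 (shearData v₁ v₃) (shearField (a j) (c j)))
    {W : ℝ → 𝕋³ → ℝ}
    (hWm : AEStronglyMeasurable (Literature.Analysis.FunctionSpaces.Torus.stLift W) (volume.restrict (Ioo 0 T ×ˢ univ)))
    (hWb : ∃ C : ℝ≥0, ∀ᵐ t ∂(volume.restrict (Ioo 0 T)), ∫⁻ x, ‖W t x‖ₑ ^ 2 ≤ C)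
    (hheat : Tendsto (fun j => ∫⁻ t in Ioo 0 T, ∫⁻ x : 𝕋³, ‖a j t (x 1) - v₁ (x 1)‖ₑ ^ 2) atTop (𝓝 0))
    (hweak : ∀ G : ℝ → 𝕋³ → ℝ,
      AEStronglyMeasurable (Literature.Analysis.FunctionSpaces.Torus.stLift G) (volume.restrict (Ioo 0 T ×ˢ univ)) →
      ∫⁻ t in Ioo 0 T, ∫⁻ x, ‖G t x‖ₑ ^ 2 < ⊤ →
      Tendsto (fun j => ∫ t in Ioo 0 T, ∫ x, c j t ![x 0, x 1] * G t x) atTop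
        (𝓝 (∫ t in Ioo 0 T, ∫ x, W t x * G t x)))
    {φ : ℝ → 𝕋² → ℝ} (hφ : Literature.Analysis.FunctionSpaces.Torus.IsSpaceTimeTest T φ) :
    (∫ t in Ioo 0 T, ∫ x : 𝕋³, W t x * (Literature.Analysis.FunctionSpaces.Torus.timeDeriv φ t ![x 0, x 1] +
        v₁ (x 1) * Literature.Analysis.FunctionSpaces.Torus.partialDeriv 0 (φ t) ![x 0, x 1])) +
      ∫ x : 𝕋³, v₃ ![x 0, x 1] * φ 0 ![x 0, x 1] = 0 := by
  -- the planar lift and the three bounded continuous kernels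
  have hΦ := isSpaceTimeTest_planarLift hφ
  set G₁ : ℝ → 𝕋³ → ℝ := fun t x => Literature.Analysis.FunctionSpaces.Torus.timeDeriv φ t ![x 0, x 1] with hG₁
  set G₂ : ℝ → 𝕋³ → ℝ := fun t x => Literature.Analysis.FunctionSpaces.Torus.partialDeriv 0 (φ t) ![x 0, x 1] with hG₂
  set L : ℝ → 𝕋³ → ℝ := fun t x => Literature.Analysis.FunctionSpaces.Torus.laplacian (fun x : 𝕋³ => φ t ![x 0, x 1]) x with hL
  have hG₁s : Continuous (Literature.Analysis.FunctionSpaces.Torus.stLift G₁) := hΦ.timeDeriv.1.continuous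
  have hG₂s : Continuous (Literature.Analysis.FunctionSpaces.Torus.stLift G₂) := by
    have h := ((hΦ.isSmoothSpaceTimeOn univ).partialDeriv uniqueDiffOn_univ 0).continuousOn_stLift
    rw [univ_prod_univ, continuousOn_univ] at h
    have heq : G₂ = fun t => Literature.Analysis.FunctionSpaces.Torus.partialDeriv 0 (fun x : 𝕋³ => φ t ![x 0, x 1]) := by
      funext t x; exact (partialDeriv_zero_planarLift φ t x).symm
    rw [heq]; exact h
  have hLs : Continuous (Literature.Analysis.FunctionSpaces.Torus.stLift L) := by
    have h := ((hΦ.isSmoothSpaceTimeOn univ).laplacian uniqueDiffOn_univ).continuousOn_stLift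
    rw [univ_prod_univ, continuousOn_univ] at h
    exact h
  obtain ⟨K₁, hK₁, hG₁m, hG₁f, hG₁L⟩ := memLp_two_uncurry_of_continuous hG₁s T
  obtain ⟨K₂, hK₂, hG₂m, hG₂f, hG₂L⟩ := memLp_two_uncurry_of_continuous hG₂s T
  obtain ⟨K₃, hK₃, hLm, hLf, hLL⟩ := memLp_two_uncurry_of_continuous hLs T
  obtain ⟨hVGm, hVGf, hVGL⟩ := admissible_shear_mul hv₁ hG₂s T
  have hae : ∀ᵐ z ∂(((volume : Measure ℝ).restrict (Ioo 0 T)).prod (volume : Measure 𝕋³)), z.1 ∈ Ioo 0 T :=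
    (Measure.quasiMeasurePreserving_fst (μ := (volume : Measure ℝ).restrict (Ioo 0 T))
      (ν := (volume : Measure 𝕋³))).ae (ae_restrict_mem measurableSet_Ioo)
  -- the components of the Leray–Hopf solutions in `L²((0,T)×T³)`
  have hmem : MemLp (shearData v₁ v₃) 2 volume := memLp_shearData hv₁ hv₃
  have hE₀ : ∫⁻ x, ‖shearData v₁ v₃ x‖ₑ ^ 2 < ⊤ := by
    rw [lintegral_enorm_sq_eq_ofReal_kineticEnergy hmem]; exact ENNReal.ofReal_lt_top
  have hA := fun j => lerayHopf_component_memLp (hν j).le hmem (hU j) 0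
  have hC := fun j => lerayHopf_component_memLp (hν j).le hmem (hU j) 2
  have hA_eq : ∀ j t (x : 𝕋³), shearField (a j) (c j) t x 0 = a j t (x 1) := fun j t x => (shearField_apply _ _ t x).1
  have hC_eq : ∀ j t (x : 𝕋³), shearField (a j) (c j) t x 2 = c j t ![x 0, x 1] := fun j t x =>
    (shearField_apply _ _ t x).2.2
  have hAL : ∀ j, MemLp (uncurry fun t (x : 𝕋³) => a j t (x 1)) 2
      (((volume : Measure ℝ).restrict (Ioo 0 T)).prod (volume : Measure 𝕋³)) := by
    intro j; have h := (hA j).2.2.2; simp_rw [hA_eq] at h; exact h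
  have hCL : ∀ j, MemLp (uncurry fun t (x : 𝕋³) => c j t ![x 0, x 1]) 2
      (((volume : Measure ℝ).restrict (Ioo 0 T)).prod (volume : Measure 𝕋³)) := by
    intro j; have h := (hC j).2.2.2; simp_rw [hC_eq] at h; exact h
  -- uniform `L²_{t,x}` bound of the third components
  set B : ℝ≥0∞ := ((∫⁻ x, ‖shearData v₁ v₃ x‖ₑ ^ 2) * volume (Ioo (0 : ℝ) T)) ^ (1 / 2 : ℝ) with hBdef
  have hBfin : B ≠ ⊤ := ENNReal.rpow_ne_top_of_nonneg (by norm_num)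
    (ENNReal.mul_ne_top hE₀.ne measure_Ioo_lt_top.ne)
  have hCB : ∀ j, eLpNorm (uncurry fun t (x : 𝕋³) => c j t ![x 0, x 1]) 2
      (((volume : Measure ℝ).restrict (Ioo 0 T)).prod (volume : Measure 𝕋³)) ≤ B := by
    intro j
    have hm : AEStronglyMeasurable (uncurry fun t (x : 𝕋³) => c j t ![x 0, x 1])
        (((volume : Measure ℝ).restrict (Ioo 0 T)).prod (volume : Measure 𝕋³)) := (hCL j).1
    have hsq : eLpNorm (uncurry fun t (x : 𝕋³) => c j t ![x 0, x 1]) 2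
        (((volume : Measure ℝ).restrict (Ioo 0 T)).prod (volume : Measure 𝕋³)) ^ 2 ≤
        (∫⁻ x, ‖shearData v₁ v₃ x‖ₑ ^ 2) * volume (Ioo (0 : ℝ) T) := by
      rw [Literature.Analysis.FunctionSpaces.eLpNorm_two_pow_two_eq_lintegral,
        lintegral_prod _ (hm.aemeasurable.enorm.pow_const 2)]
      calc ∫⁻ t in Ioo 0 T, ∫⁻ x : 𝕋³, ‖uncurry (fun t (x : 𝕋³) => c j t ![x 0, x 1]) (t, x)‖ₑ ^ 2
          ≤ ∫⁻ _ in Ioo (0 : ℝ) T, ∫⁻ x, ‖shearData v₁ v₃ x‖ₑ ^ 2 := by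
            refine setLIntegral_mono measurable_const fun t ht => ?_
            have h := (hC j).2.1 t (Ioo_subset_Icc_self ht)
            simp_rw [hC_eq] at h
            exact h
        _ = (∫⁻ x, ‖shearData v₁ v₃ x‖ₑ ^ 2) * volume (Ioo (0 : ℝ) T) := by
            rw [lintegral_const, Measure.restrict_apply_univ]
    rw [Literature.Analysis.FunctionSpaces.eLpNorm_two_eq_pow_two_rpow_half, hBdef]
    exact ENNReal.rpow_le_rpow hsq (by norm_num)
  -- the limit field in `L²((0,T)×T³)`
  obtain ⟨Cw, hCw⟩ := hWb
  have hWfin : ∫⁻ t in Ioo 0 T, ∫⁻ x, ‖W t x‖ₑ ^ 2 < ⊤ := by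
    refine (lintegral_mono_ae hCw).trans_lt ?_
    rw [lintegral_const, Measure.restrict_apply_univ]
    exact ENNReal.mul_lt_top ENNReal.coe_lt_top measure_Ioo_lt_top
  have hWL : MemLp (uncurry W) 2 (((volume : Measure ℝ).restrict (Ioo 0 T)).prod (volume : Measure 𝕋³)) :=
    (Literature.Analysis.FunctionSpaces.Torus.memLp_two_uncurry
      (Literature.Analysis.FunctionSpaces.Torus.aestronglyMeasurable_uncurry_of_stLift_prod hWm) hWfin).1
  -- integrability of the three summands, for each `j`
  have i1 : ∀ j, Integrable (fun z : ℝ × 𝕋³ => c j z.1 ![z.2 0, z.2 1] * G₁ z.1 z.2)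
      (((volume : Measure ℝ).restrict (Ioo 0 T)).prod (volume : Measure 𝕋³)) := fun j => (hCL j).integrable_mul hG₁L
  have i2 : ∀ j, Integrable (fun z : ℝ × 𝕋³ => c j z.1 ![z.2 0, z.2 1] * (a j z.1 (z.2 1) * G₂ z.1 z.2))
      (((volume : Measure ℝ).restrict (Ioo 0 T)).prod (volume : Measure 𝕋³)) := by
    intro j
    refine (((hCL j).integrable_mul (hAL j)).bdd_mul (c := K₂) hG₂L.1 (hae.mono fun z hz => ?_)).congr
      (Eventually.of_forall fun z => ?_)
    · exact hK₂ z.1 (Ioo_subset_Icc_self hz) z.2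
    · obtain ⟨t, x⟩ := z
      simp only [uncurry_apply_pair, Pi.mul_apply]; ring
  have i3 : ∀ j, Integrable (fun z : ℝ × 𝕋³ => ν j * (c j z.1 ![z.2 0, z.2 1] * L z.1 z.2))
      (((volume : Measure ℝ).restrict (Ioo 0 T)).prod (volume : Measure 𝕋³)) := fun j =>
    ((hCL j).integrable_mul hLL).const_mul (ν j)
  -- the tested identities, split into three pairings
  set D : ℝ := ∫ x : 𝕋³, v₃ ![x 0, x 1] * φ 0 ![x 0, x 1] with hD
  set P : ℕ → ℝ := fun j => ∫ t in Ioo 0 T, ∫ x : 𝕋³, c j t ![x 0, x 1] * G₁ t x with hP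
  set Q : ℕ → ℝ := fun j => ∫ t in Ioo 0 T, ∫ x : 𝕋³, c j t ![x 0, x 1] * (a j t (x 1) * G₂ t x) with hQ
  set R : ℕ → ℝ := fun j => ∫ t in Ioo 0 T, ∫ x : 𝕋³, c j t ![x 0, x 1] * L t x with hR
  have hid : ∀ j, P j + Q j + ν j * R j + D = 0 := by
    intro j
    have h := shearField_weak_vertical (hU j) hφ
    have hs : ∫ t in Ioo 0 T, ∫ x : 𝕋³, (c j t ![x 0, x 1] * G₁ t x + c j t ![x 0, x 1] * (a j t (x 1) * G₂ t x) +
        ν j * (c j t ![x 0, x 1] * L t x)) = P j + Q j + ∫ t in Ioo 0 T, ∫ x : 𝕋³, ν j * (c j t ![x 0, x 1] * L t x) :=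
      setIntegral_integral_add₃ (i1 j) (i2 j) (i3 j)
    rw [hs] at h
    have hR' : ∫ t in Ioo 0 T, ∫ x : 𝕋³, ν j * (c j t ![x 0, x 1] * L t x) = ν j * R j := by
      rw [hR]; simp_rw [MeasureTheory.integral_const_mul]
    rw [hR'] at h
    exact h
  -- limits of the three pairings
  have hPlim : Tendsto P atTop (𝓝 (∫ t in Ioo 0 T, ∫ x, W t x * G₁ t x)) := hweak G₁ hG₁m hG₁f
  have hRb : ∀ j, |R j| ≤ B.toReal * (eLpNorm (uncurry L) 2
      (((volume : Measure ℝ).restrict (Ioo 0 T)).prod (volume : Measure 𝕋³))).toReal := by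
    intro j
    have iCL : Integrable (uncurry fun t (x : 𝕋³) => c j t ![x 0, x 1] * L t x)
        (((volume : Measure ℝ).restrict (Ioo 0 T)).prod (volume : Measure 𝕋³)) := (hCL j).integrable_mul hLL
    have hRj : R j = ∫ z, c j z.1 ![z.2 0, z.2 1] * L z.1 z.2
        ∂(((volume : Measure ℝ).restrict (Ioo 0 T)).prod (volume : Measure 𝕋³)) :=
      integral_integral iCL
    rw [hRj]
    refine (abs_integral_mul_le_of_memLp_two (hCL j) hLL).trans ?_
    exact mul_le_mul_of_nonneg_right (ENNReal.toReal_mono hBfin (hCB j)) ENNReal.toReal_nonneg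
  have hRlim : Tendsto (fun j => ν j * R j) atTop (𝓝 0) := by
    have hb : Tendsto (fun j => ν j * (B.toReal * (eLpNorm (uncurry L) 2
        (((volume : Measure ℝ).restrict (Ioo 0 T)).prod (volume : Measure 𝕋³))).toReal)) atTop (𝓝 0) := by
      simpa using hν₀.mul_const _
    refine squeeze_zero_norm (fun j => ?_) hb
    rw [Real.norm_eq_abs, abs_mul, abs_of_pos (hν j)]
    exact mul_le_mul_of_nonneg_left (hRb j) (hν j).le
  -- the product term: `C_j (A_j - V₁) G₂ → 0` strongly, `C_j V₁ G₂ → W V₁ G₂` weakly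
  have hVL : MemLp (uncurry fun (_ : ℝ) (x : 𝕋³) => v₁ (x 1)) 2
      (((volume : Measure ℝ).restrict (Ioo 0 T)).prod (volume : Measure 𝕋³)) := memLp_uncurry_const_eval_one hv₁
  have hdL : ∀ j, MemLp (fun z : ℝ × 𝕋³ => (a j z.1 (z.2 1) - v₁ (z.2 1)) * G₂ z.1 z.2) 2
      (((volume : Measure ℝ).restrict (Ioo 0 T)).prod (volume : Measure 𝕋³)) ∧
      eLpNorm (fun z : ℝ × 𝕋³ => (a j z.1 (z.2 1) - v₁ (z.2 1)) * G₂ z.1 z.2) 2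
        (((volume : Measure ℝ).restrict (Ioo 0 T)).prod (volume : Measure 𝕋³)) ≤
        ENNReal.ofReal K₂ * eLpNorm (fun z : ℝ × 𝕋³ => a j z.1 (z.2 1) - v₁ (z.2 1)) 2
          (((volume : Measure ℝ).restrict (Ioo 0 T)).prod (volume : Measure 𝕋³)) := by
    intro j
    have hd : MemLp (fun z : ℝ × 𝕋³ => a j z.1 (z.2 1) - v₁ (z.2 1)) 2
        (((volume : Measure ℝ).restrict (Ioo 0 T)).prod (volume : Measure 𝕋³)) := (hAL j).sub hVL
    have hle : ∀ᵐ z ∂(((volume : Measure ℝ).restrict (Ioo 0 T)).prod (volume : Measure 𝕋³)),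
        ‖(a j z.1 (z.2 1) - v₁ (z.2 1)) * G₂ z.1 z.2‖ ≤ K₂ * ‖a j z.1 (z.2 1) - v₁ (z.2 1)‖ := by
      filter_upwards [hae] with z hz
      rw [norm_mul, mul_comm]
      exact mul_le_mul_of_nonneg_right (hK₂ z.1 (Ioo_subset_Icc_self hz) z.2) (norm_nonneg _)
    exact ⟨hd.of_le_mul (hd.1.mul hG₂L.1) hle, eLpNorm_le_mul_eLpNorm_of_ae_le_mul hle 2⟩
  have hheat' : Tendsto (fun j => (eLpNorm (fun z : ℝ × 𝕋³ => a j z.1 (z.2 1) - v₁ (z.2 1)) 2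
      (((volume : Measure ℝ).restrict (Ioo 0 T)).prod (volume : Measure 𝕋³))).toReal) atTop (𝓝 0) := by
    have hsq : ∀ j, eLpNorm (fun z : ℝ × 𝕋³ => a j z.1 (z.2 1) - v₁ (z.2 1)) 2
        (((volume : Measure ℝ).restrict (Ioo 0 T)).prod (volume : Measure 𝕋³)) =
        (∫⁻ t in Ioo 0 T, ∫⁻ x : 𝕋³, ‖a j t (x 1) - v₁ (x 1)‖ₑ ^ 2) ^ (1 / 2 : ℝ) := by
      intro j
      have hm : AEStronglyMeasurable (fun z : ℝ × 𝕋³ => a j z.1 (z.2 1) - v₁ (z.2 1))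
          (((volume : Measure ℝ).restrict (Ioo 0 T)).prod (volume : Measure 𝕋³)) := ((hAL j).sub hVL).1
      rw [Literature.Analysis.FunctionSpaces.eLpNorm_two_eq_pow_two_rpow_half,
        Literature.Analysis.FunctionSpaces.eLpNorm_two_pow_two_eq_lintegral,
        lintegral_prod _ (hm.aemeasurable.enorm.pow_const 2)]
    simp_rw [hsq]
    have h0 : (0 : ℝ≥0∞) ^ (1 / 2 : ℝ) = 0 := ENNReal.zero_rpow_of_pos (by norm_num)
    have h1 : Tendsto (fun j => (∫⁻ t in Ioo 0 T, ∫⁻ x : 𝕋³, ‖a j t (x 1) - v₁ (x 1)‖ₑ ^ 2) ^ (1 / 2 : ℝ)) atTop (𝓝 0) := by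
      rw [← h0]; exact ((ENNReal.continuous_rpow_const (y := (1 / 2 : ℝ))).tendsto 0).comp hheat
    have := (ENNReal.tendsto_toReal ENNReal.zero_ne_top).comp h1
    rwa [ENNReal.toReal_zero] at this
  have hQ1 : Tendsto (fun j => ∫ t in Ioo 0 T, ∫ x : 𝕋³, c j t ![x 0, x 1] * ((a j t (x 1) - v₁ (x 1)) * G₂ t x))
      atTop (𝓝 0) := by
    have hb : Tendsto (fun j => B.toReal * (ENNReal.ofReal K₂ * eLpNorm (fun z : ℝ × 𝕋³ => a j z.1 (z.2 1) - v₁ (z.2 1)) 2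
        (((volume : Measure ℝ).restrict (Ioo 0 T)).prod (volume : Measure 𝕋³))).toReal) atTop (𝓝 0) := by
      simp_rw [ENNReal.toReal_mul]
      simpa using (hheat'.const_mul (ENNReal.ofReal K₂).toReal).const_mul B.toReal
    refine squeeze_zero_norm (fun j => ?_) hb
    have iCd : Integrable (uncurry fun t (x : 𝕋³) => c j t ![x 0, x 1] * ((a j t (x 1) - v₁ (x 1)) * G₂ t x))
        (((volume : Measure ℝ).restrict (Ioo 0 T)).prod (volume : Measure 𝕋³)) := (hCL j).integrable_mul (hdL j).1
    rw [Real.norm_eq_abs, integral_integral iCd]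
    refine (abs_integral_mul_le_of_memLp_two (hCL j) (hdL j).1).trans ?_
    refine mul_le_mul (ENNReal.toReal_mono hBfin (hCB j)) (ENNReal.toReal_mono ?_ (hdL j).2)
      ENNReal.toReal_nonneg ENNReal.toReal_nonneg
    exact ENNReal.mul_ne_top ENNReal.ofReal_ne_top ((hAL j).sub hVL).eLpNorm_ne_top
  have hQ2 : Tendsto (fun j => ∫ t in Ioo 0 T, ∫ x : 𝕋³, c j t ![x 0, x 1] * (v₁ (x 1) * G₂ t x)) atTop
      (𝓝 (∫ t in Ioo 0 T, ∫ x, W t x * (v₁ (x 1) * G₂ t x))) := hweak _ hVGm hVGf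
  have hQlim : Tendsto Q atTop (𝓝 (∫ t in Ioo 0 T, ∫ x, W t x * (v₁ (x 1) * G₂ t x))) := by
    have hsplit : ∀ j, Q j = (∫ t in Ioo 0 T, ∫ x : 𝕋³, c j t ![x 0, x 1] * ((a j t (x 1) - v₁ (x 1)) * G₂ t x)) +
        ∫ t in Ioo 0 T, ∫ x : 𝕋³, c j t ![x 0, x 1] * (v₁ (x 1) * G₂ t x) := by
      intro j
      have i₁ : Integrable (uncurry fun t (x : 𝕋³) => c j t ![x 0, x 1] * ((a j t (x 1) - v₁ (x 1)) * G₂ t x))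
          (((volume : Measure ℝ).restrict (Ioo 0 T)).prod (volume : Measure 𝕋³)) := (hCL j).integrable_mul (hdL j).1
      have i₂ : Integrable (uncurry fun t (x : 𝕋³) => c j t ![x 0, x 1] * (v₁ (x 1) * G₂ t x))
          (((volume : Measure ℝ).restrict (Ioo 0 T)).prod (volume : Measure 𝕋³)) := (hCL j).integrable_mul hVGL
      rw [← setIntegral_integral_add₂ i₁ i₂]
      refine integral_congr_ae (Eventually.of_forall fun t => integral_congr_ae (Eventually.of_forall fun x => ?_))
      ring
    rw [show Q = fun j => (∫ t in Ioo 0 T, ∫ x : 𝕋³, c j t ![x 0, x 1] * ((a j t (x 1) - v₁ (x 1)) * G₂ t x)) +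
        ∫ t in Ioo 0 T, ∫ x : 𝕋³, c j t ![x 0, x 1] * (v₁ (x 1) * G₂ t x) from funext hsplit]
    simpa using hQ1.add hQ2
  -- conclusion
  have hS : Tendsto (fun j => P j + Q j + ν j * R j) atTop
      (𝓝 ((∫ t in Ioo 0 T, ∫ x, W t x * G₁ t x) + (∫ t in Ioo 0 T, ∫ x, W t x * (v₁ (x 1) * G₂ t x)) + 0)) :=
    (hPlim.add hQlim).add hRlim
  have hS' : Tendsto (fun j => P j + Q j + ν j * R j) atTop (𝓝 (-D)) := by
    have : (fun j => P j + Q j + ν j * R j) = fun _ => -D := by funext j; linarith [hid j]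
    rw [this]; exact tendsto_const_nhds
  have hlim := tendsto_nhds_unique hS hS'
  have hWsplit : ∫ t in Ioo 0 T, ∫ x : 𝕋³, W t x * (G₁ t x + v₁ (x 1) * G₂ t x) =
      (∫ t in Ioo 0 T, ∫ x, W t x * G₁ t x) + ∫ t in Ioo 0 T, ∫ x, W t x * (v₁ (x 1) * G₂ t x) := by
    have i₁ : Integrable (uncurry fun t (x : 𝕋³) => W t x * G₁ t x)
        (((volume : Measure ℝ).restrict (Ioo 0 T)).prod (volume : Measure 𝕋³)) := hWL.integrable_mul hG₁L
    have i₂ : Integrable (uncurry fun t (x : 𝕋³) => W t x * (v₁ (x 1) * G₂ t x))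
        (((volume : Measure ℝ).restrict (Ioo 0 T)).prod (volume : Measure 𝕋³)) := hWL.integrable_mul hVGL
    rw [← setIntegral_integral_add₂ i₁ i₂]
    refine integral_congr_ae (Eventually.of_forall fun t => integral_congr_ae (Eventually.of_forall fun x => ?_))
    ring
  rw [hWsplit]
  linarith

end Limit

/-! ## Fibre averages along the third coordinate -/

section FibreAvg

/-- The gluing map `T² × T → T³`, `((y₁,y₂), s) ↦ (y₁, y₂, s)`, preserves the Haar measures. [folklore] -/
theorem measurePreserving_glue :
    MeasurePreserving (fun p : 𝕋² × UnitAddCircle => (![p.1 0, p.1 1, p.2] : 𝕋³)) (volume.prod volume) volume := by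
  have hmp : MeasurePreserving (MeasurableEquiv.piFinSuccAbove (fun _ : Fin 3 => UnitAddCircle) 2).symm
      ((volume : Measure UnitAddCircle).prod (Measure.pi fun _ : Fin 2 => (volume : Measure UnitAddCircle)))
      (Measure.pi fun _ : Fin 3 => (volume : Measure UnitAddCircle)) :=
    (measurePreserving_piFinSuccAbove (fun _ : Fin 3 => (volume : Measure UnitAddCircle)) 2).symm
  have heq : (fun p : 𝕋² × UnitAddCircle => (![p.1 0, p.1 1, p.2] : 𝕋³)) =
      (MeasurableEquiv.piFinSuccAbove (fun _ : Fin 3 => UnitAddCircle) 2).symm ∘ Prod.swap := by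
    funext p; obtain ⟨y, s⟩ := p; exact (insertNth_two_eq s y).symm
  rw [heq, MeasureTheory.volume_pi]
  have hsw : MeasurePreserving (Prod.swap : 𝕋² × UnitAddCircle → UnitAddCircle × 𝕋²) (volume.prod volume)
      ((volume : Measure UnitAddCircle).prod (Measure.pi fun _ : Fin 2 => (volume : Measure UnitAddCircle))) := by
    rw [← MeasureTheory.volume_pi]; exact Measure.measurePreserving_swap
  exact hmp.comp hsw

/-- The gluing map is a measurable embedding (a measurable equivalence up to reordering). [folklore] -/
theorem measurableEmbedding_glue :
    MeasurableEmbedding (fun p : 𝕋² × UnitAddCircle => (![p.1 0, p.1 1, p.2] : 𝕋³)) := by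
  have heq : (fun p : 𝕋² × UnitAddCircle => (![p.1 0, p.1 1, p.2] : 𝕋³)) =
      (MeasurableEquiv.piFinSuccAbove (fun _ : Fin 3 => UnitAddCircle) 2).symm ∘
        (MeasurableEquiv.prodComm : 𝕋² × UnitAddCircle ≃ᵐ UnitAddCircle × 𝕋²) := by
    funext p; obtain ⟨y, s⟩ := p; exact (insertNth_two_eq s y).symm
  rw [heq]
  exact (MeasurableEquiv.measurableEmbedding _).comp (MeasurableEquiv.measurableEmbedding _)

/-- **Measurability of fibre averages**: if `uncurry W` is a.e. strongly measurable for
`μ ⊗ vol_{T³}`, so is `uncurry` of `(t, y) ↦ ∫_T W(t, (y, s)) ds` for `μ ⊗ vol_{T²}`. [folklore] -/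
theorem aestronglyMeasurable_uncurry_fibreAvg {W : ℝ → 𝕋³ → ℝ} (μ : Measure ℝ) [SFinite μ]
    (hW : AEStronglyMeasurable (uncurry W) (μ.prod volume)) :
    AEStronglyMeasurable (uncurry fun t (y : 𝕋²) => ∫ s : UnitAddCircle, W t ![y 0, y 1, s]) (μ.prod volume) := by
  have hΨ : MeasurePreserving (fun q : (ℝ × 𝕋²) × UnitAddCircle => (q.1.1, (![q.1.2 0, q.1.2 1, q.2] : 𝕋³)))
      ((μ.prod volume).prod volume) (μ.prod volume) := by
    have h1 : MeasurePreserving (Prod.map id fun p : 𝕋² × UnitAddCircle => (![p.1 0, p.1 1, p.2] : 𝕋³))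
        (μ.prod (volume.prod volume)) (μ.prod volume) := (MeasurePreserving.id μ).prod measurePreserving_glue
    have h2 : MeasurePreserving (Equiv.prodAssoc ℝ 𝕋² UnitAddCircle) ((μ.prod volume).prod volume)
        (μ.prod (volume.prod volume)) := measurePreserving_prodAssoc μ volume volume
    exact h1.comp h2
  exact (hW.comp_measurePreserving hΨ).integral_prod_right'

/-- **Jensen for fibre averages**: `∫_{T²} ‖∫_T F(y,s) ds‖² dy ≤ ∫_{T³} ‖F‖²`. [folklore] -/
theorem lintegral_enorm_sq_fibreAvg_le {F : 𝕋³ → ℝ} (hF : AEStronglyMeasurable F volume) :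
    ∫⁻ y : 𝕋², ‖∫ s : UnitAddCircle, F ![y 0, y 1, s]‖ₑ ^ 2 ≤ ∫⁻ x, ‖F x‖ₑ ^ 2 := by
  have hFg : AEStronglyMeasurable (fun p : 𝕋² × UnitAddCircle => F ![p.1 0, p.1 1, p.2]) (volume.prod volume) :=
    hF.comp_measurePreserving measurePreserving_glue
  -- slicewise Jensen (Cauchy–Schwarz against `1` on the probability space `T`)
  have hslice : ∀ y : 𝕋², AEMeasurable (fun s : UnitAddCircle => ‖F ![y 0, y 1, s]‖ₑ) volume →
      ‖∫ s : UnitAddCircle, F ![y 0, y 1, s]‖ₑ ^ 2 ≤ ∫⁻ s : UnitAddCircle, ‖F ![y 0, y 1, s]‖ₑ ^ 2 := by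
    intro y hm
    have h1 : ‖∫ s : UnitAddCircle, F ![y 0, y 1, s]‖ₑ ≤ ∫⁻ s : UnitAddCircle, ‖F ![y 0, y 1, s]‖ₑ :=
      enorm_integral_le_lintegral_enorm _
    have h2 := ENNReal.lintegral_mul_le_Lp_mul_Lq volume Real.HolderConjugate.two_two hm aemeasurable_const
      (g := fun _ => (1 : ℝ≥0∞))
    simp only [Pi.mul_apply, mul_one, ENNReal.one_rpow, lintegral_const, measure_univ, one_div] at h2
    calc ‖∫ s : UnitAddCircle, F ![y 0, y 1, s]‖ₑ ^ 2 ≤ (∫⁻ s : UnitAddCircle, ‖F ![y 0, y 1, s]‖ₑ) ^ 2 := by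
          gcongr
      _ ≤ ((∫⁻ s : UnitAddCircle, ‖F ![y 0, y 1, s]‖ₑ ^ (2 : ℝ)) ^ (2 : ℝ)⁻¹) ^ 2 := by gcongr
      _ = ∫⁻ s : UnitAddCircle, ‖F ![y 0, y 1, s]‖ₑ ^ 2 := by
          rw [← ENNReal.rpow_natCast, ← ENNReal.rpow_mul]
          norm_num
  have hae : ∀ᵐ y : 𝕋² ∂volume, AEMeasurable (fun s : UnitAddCircle => ‖F ![y 0, y 1, s]‖ₑ) volume := by
    filter_upwards [hFg.prodMk_left] with y hy
    exact hy.aemeasurable.enorm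
  calc ∫⁻ y : 𝕋², ‖∫ s : UnitAddCircle, F ![y 0, y 1, s]‖ₑ ^ 2
      ≤ ∫⁻ y : 𝕋², ∫⁻ s : UnitAddCircle, ‖F ![y 0, y 1, s]‖ₑ ^ 2 := lintegral_mono_ae (hae.mono fun y hy => hslice y hy)
    _ = ∫⁻ p : 𝕋² × UnitAddCircle, ‖F ![p.1 0, p.1 1, p.2]‖ₑ ^ 2 ∂(volume.prod volume) :=
        (lintegral_prod _ (hFg.aemeasurable.enorm.pow_const 2)).symm
    _ = ∫⁻ x, ‖F x‖ₑ ^ 2 := measurePreserving_glue.lintegral_comp_emb measurableEmbedding_glue (fun x : 𝕋³ => ‖F x‖ₑ ^ 2)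

end FibreAvg

/-! ## The fibre average of the limit is a weak solution of the shear transport equation on `T²` -/

section Descent

variable {T : ℝ} {v : UnitAddCircle → ℝ} {v₃ : 𝕋² → ℝ} {W : ℝ → 𝕋³ → ℝ}

/-- Integration of a planar function over `T³` reduces to `T²`. [folklore] -/
theorem integral_planarLift {g : 𝕋² → ℝ} (hg : AEStronglyMeasurable g volume) :
    ∫ x : 𝕋³, g ![x 0, x 1] = ∫ y : 𝕋², g y := by
  have h := measurePreserving_proj₀₁
  rw [← integral_map h.measurable.aemeasurable (by rw [h.map_eq]; exact hg), h.map_eq]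

/-- `lintegral` of a planar function over `T³` reduces to `T²`. [folklore] -/
theorem lintegral_planarLift {g : 𝕋² → ℝ≥0∞} (hg : AEMeasurable g volume) :
    ∫⁻ x : 𝕋³, g ![x 0, x 1] = ∫⁻ y : 𝕋², g y := by
  have h := measurePreserving_proj₀₁
  rw [← lintegral_map' (by rw [h.map_eq]; exact hg) h.measurable.aemeasurable, h.map_eq]

/-- **The fibre average `w̄(t,y) = ∫_T W(t,(y,s)) ds` of the weak limit is a weak solution of
`∂ₜw̄ + v(y₂)∂₁w̄ = 0` on `T² × (0,T)` with datum `v₃`, in `L^∞(0,T;L²(T²))`** (measurable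
`v ∈ L²(T)`), given the limit identity against planar lifts (`limit_weak_vertical`): the
pairing of `W` with a planar function is the pairing of `w̄` with it (`integral_planar_mul`),
and `‖w̄(t)‖_{L²(T²)} ≤ ‖W(t)‖_{L²(T³)}` (Jensen, `lintegral_enorm_sq_fibreAvg_le`). [cite: BardosTitiWiedemann2012, Thm. 5, proof] -/
theorem isWeakScalarTransportOn_fibreAvg (hv : Measurable v) (hv2 : MemLp v 2 volume) (hv₃ : MemLp v₃ 2 volume)
    (hWm : AEStronglyMeasurable (uncurry W) (((volume : Measure ℝ).restrict (Ioo 0 T)).prod (volume : Measure 𝕋³)))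
    (hWb : ∃ C : ℝ≥0, ∀ᵐ t ∂(volume.restrict (Ioo 0 T)), ∫⁻ x, ‖W t x‖ₑ ^ 2 ≤ C)
    (hWid : ∀ φ : ℝ → 𝕋² → ℝ, Literature.Analysis.FunctionSpaces.Torus.IsSpaceTimeTest T φ →
      (∫ t in Ioo 0 T, ∫ x : 𝕋³, W t x * (Literature.Analysis.FunctionSpaces.Torus.timeDeriv φ t ![x 0, x 1] +
          v (x 1) * Literature.Analysis.FunctionSpaces.Torus.partialDeriv 0 (φ t) ![x 0, x 1])) +
        ∫ x : 𝕋³, v₃ ![x 0, x 1] * φ 0 ![x 0, x 1] = 0) :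
    Literature.Analysis.FluidPDE.Torus.IsWeakScalarTransportOn T 0 (shearVelocity v) v₃
      (fun t (y : 𝕋²) => ∫ s : UnitAddCircle, W t ![y 0, y 1, s]) := by
  have hv1 : MemLp (fun x : 𝕋² => v (x 1)) 2 volume :=
    hv2.comp_measurePreserving (measurePreserving_eval (fun _ : Fin 2 => (volume : Measure UnitAddCircle)) 1)
  have hEv : ∫⁻ x : 𝕋², ‖v (x 1)‖ₑ ^ 2 < ⊤ := by
    rw [← Literature.Analysis.FunctionSpaces.eLpNorm_two_pow_two_eq_lintegral]
    exact ENNReal.pow_lt_top hv1.eLpNorm_lt_top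
  have hu_sq : ∀ t (x : 𝕋²), ‖shearVelocity v t x‖ₑ ^ 2 = ‖v (x 1)‖ₑ ^ 2 := fun t x => by
    rw [shearVelocity, enorm_vec2_zero]
  have hu_en : ∀ t (x : 𝕋²), ‖shearVelocity v t x‖ₑ = ‖v (x 1)‖ₑ := fun t x => by
    rw [shearVelocity, enorm_vec2_zero]
  have hvol : volume (Ioo (0 : ℝ) T) < ⊤ := measure_Ioo_lt_top
  obtain ⟨C, hC⟩ := hWb
  -- measurability of the fibre average and of the slices
  have hwm : AEStronglyMeasurable (uncurry fun t (y : 𝕋²) => ∫ s : UnitAddCircle, W t ![y 0, y 1, s])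
      (((volume : Measure ℝ).restrict (Ioo 0 T)).prod (volume : Measure 𝕋²)) :=
    aestronglyMeasurable_uncurry_fibreAvg _ hWm
  have hWslice : ∀ᵐ t ∂(volume.restrict (Ioo (0 : ℝ) T)), AEStronglyMeasurable (W t) volume := by
    have h0 : ∀ᵐ t ∂(volume.restrict (Ioo (0 : ℝ) T)), AEStronglyMeasurable (fun x : 𝕋³ => uncurry W (t, x)) volume :=
      hWm.prodMk_left
    exact h0.mono fun t ht => ht
  have hwslice : ∀ᵐ t ∂(volume.restrict (Ioo (0 : ℝ) T)),
      AEStronglyMeasurable (fun y : 𝕋² => ∫ s : UnitAddCircle, W t ![y 0, y 1, s]) volume := by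
    have h0 : ∀ᵐ t ∂(volume.restrict (Ioo (0 : ℝ) T)), AEStronglyMeasurable
        (fun y : 𝕋² => uncurry (fun t (y : 𝕋²) => ∫ s : UnitAddCircle, W t ![y 0, y 1, s]) (t, y)) volume :=
      hwm.prodMk_left
    exact h0.mono fun t ht => ht
  -- the slice bound (Jensen)
  have hwb : ∀ᵐ t ∂(volume.restrict (Ioo (0 : ℝ) T)),
      ∫⁻ y : 𝕋², ‖∫ s : UnitAddCircle, W t ![y 0, y 1, s]‖ₑ ^ 2 ≤ C := by
    filter_upwards [hC, hWslice] with t ht hm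
    exact (lintegral_enorm_sq_fibreAvg_le hm).trans ht
  refine ⟨?_, ?_, ⟨C, hwb⟩, ?_, ?_, Eventually.of_forall fun t => isWeaklyDivFree_shearVelocity hv2 t, fun ψ hψ => ?_⟩
  · exact Literature.Analysis.FunctionSpaces.Torus.aestronglyMeasurable_stLift_of_uncurry hwm
  · exact Literature.Analysis.FunctionSpaces.Torus.aestronglyMeasurable_stLift_of_uncurry
      (aestronglyMeasurable_uncurry_shearVelocity hv _)
  · calc ∫⁻ t in Ioo 0 T, (∫⁻ x, ‖shearVelocity v t x‖ₑ ^ 2) ^ (1 / 2 : ℝ)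
        = ∫⁻ _ in Ioo (0 : ℝ) T, (∫⁻ x : 𝕋², ‖v (x 1)‖ₑ ^ 2) ^ (1 / 2 : ℝ) := by simp_rw [hu_sq]
      _ < ⊤ := by
          rw [lintegral_const, Measure.restrict_apply_univ]
          exact ENNReal.mul_lt_top (ENNReal.rpow_lt_top_of_nonneg (by norm_num) hEv.ne) hvol
  · have hslice : ∀ᵐ t ∂(volume.restrict (Ioo (0 : ℝ) T)),
        ∫⁻ y, ‖shearVelocity v t y‖ₑ * ‖∫ s : UnitAddCircle, W t ![y 0, y 1, s]‖ₑ ≤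
        (∫⁻ x : 𝕋², ‖v (x 1)‖ₑ ^ 2) ^ (1 / 2 : ℝ) * (C : ℝ≥0∞) ^ (1 / 2 : ℝ) := by
      filter_upwards [hwb, hwslice] with t ht hm
      have hf' : Measurable fun y : 𝕋² => shearVelocity v t y :=
        continuous_vec2_zero.measurable.comp (hv.comp (measurable_pi_apply 1))
      have hf : AEMeasurable (fun y => ‖shearVelocity v t y‖ₑ) volume := hf'.enorm.aemeasurable
      have hg : AEMeasurable (fun y : 𝕋² => ‖∫ s : UnitAddCircle, W t ![y 0, y 1, s]‖ₑ) volume := hm.aemeasurable.enorm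
      have h := ENNReal.lintegral_mul_le_Lp_mul_Lq volume Real.HolderConjugate.two_two hf hg
      simp only [Pi.mul_apply, one_div] at h
      refine h.trans ?_
      simp_rw [hu_en]
      gcongr
      · simp
      · calc (∫⁻ y : 𝕋², ‖∫ s : UnitAddCircle, W t ![y 0, y 1, s]‖ₑ ^ (2 : ℝ)) ^ (2 : ℝ)⁻¹
            = (∫⁻ y : 𝕋², ‖∫ s : UnitAddCircle, W t ![y 0, y 1, s]‖ₑ ^ 2) ^ (1 / 2 : ℝ) := by simp
          _ ≤ (C : ℝ≥0∞) ^ (1 / 2 : ℝ) := ENNReal.rpow_le_rpow ht (by norm_num)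
    calc ∫⁻ t in Ioo 0 T, ∫⁻ y, ‖shearVelocity v t y‖ₑ * ‖∫ s : UnitAddCircle, W t ![y 0, y 1, s]‖ₑ
        ≤ ∫⁻ _ in Ioo (0 : ℝ) T, (∫⁻ x : 𝕋², ‖v (x 1)‖ₑ ^ 2) ^ (1 / 2 : ℝ) * (C : ℝ≥0∞) ^ (1 / 2 : ℝ) :=
          lintegral_mono_ae hslice
      _ < ⊤ := by
          rw [lintegral_const, Measure.restrict_apply_univ]
          exact ENNReal.mul_lt_top (ENNReal.mul_lt_top (ENNReal.rpow_lt_top_of_nonneg (by norm_num) hEv.ne)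
            (ENNReal.rpow_lt_top_of_nonneg (by norm_num) ENNReal.coe_ne_top)) hvol
  · -- the weak formulation: descend the limit identity
    have hid := hWid ψ hψ
    have hpt : ∀ t (y : 𝕋²), Literature.Analysis.FunctionSpaces.Torus.timeDeriv ψ t y +
        ⟪shearVelocity v t y, Literature.Analysis.FunctionSpaces.Torus.gradient (ψ t) y⟫ +
        0 * Literature.Analysis.FunctionSpaces.Torus.laplacian (ψ t) y =
        Literature.Analysis.FunctionSpaces.Torus.timeDeriv ψ t y +
          v (y 1) * Literature.Analysis.FunctionSpaces.Torus.partialDeriv 0 (ψ t) y := fun t y => by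
      rw [inner_shearVelocity_gradient v ((hψ.isSmooth_slice t).isContDiff (by simp)), zero_mul, add_zero]
    simp_rw [hpt]
    -- the kernel `G(t,y) = ∂ₜψ + v(y₂)∂₁ψ` is in `L²(T²)` slicewise, with a uniform bound
    obtain ⟨K₁, hK₁⟩ := Literature.Analysis.FunctionSpaces.Torus.exists_norm_le_of_continuousOn_of_isCompact
      (S := univ) hψ.timeDeriv.1.continuous.continuousOn isCompact_Icc (subset_univ (Icc (0 : ℝ) T))
    obtain ⟨K₂, hK₂⟩ := Literature.Analysis.FunctionSpaces.Torus.exists_norm_le_of_continuousOn_of_isCompact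
      (S := univ) ((hψ.isSmoothSpaceTimeOn univ).partialDeriv uniqueDiffOn_univ 0).continuousOn_stLift
      isCompact_Icc (subset_univ (Icc (0 : ℝ) T))
    have hGL : ∀ t ∈ Ioo (0 : ℝ) T, MemLp (fun y : 𝕋² => Literature.Analysis.FunctionSpaces.Torus.timeDeriv ψ t y +
        v (y 1) * Literature.Analysis.FunctionSpaces.Torus.partialDeriv 0 (ψ t) y) 2 volume := by
      intro t ht
      have h1 : MemLp (fun y : 𝕋² => Literature.Analysis.FunctionSpaces.Torus.timeDeriv ψ t y) 2 volume :=
        (memLp_top_of_bound (hψ.timeDeriv.isSmooth_slice t).continuous.aestronglyMeasurable K₁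
          (Eventually.of_forall fun y => hK₁ t (Ioo_subset_Icc_self ht) y)).mono_exponent le_top
      have h2 : MemLp (fun y : 𝕋² => v (y 1) * Literature.Analysis.FunctionSpaces.Torus.partialDeriv 0 (ψ t) y) 2 volume := by
        refine hv1.of_le_mul (c := K₂) (hv1.1.mul ((hψ.isSmooth_slice t).partialDeriv 0).continuous.aestronglyMeasurable)
          (Eventually.of_forall fun y => ?_)
        rw [norm_mul, mul_comm]
        exact mul_le_mul_of_nonneg_right (hK₂ t (Ioo_subset_Icc_self ht) y) (norm_nonneg _)
      exact h1.add h2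
    -- descent of the space–time pairing, slicewise for a.e. `t`
    have hdesc : ∀ᵐ t ∂(volume.restrict (Ioo (0 : ℝ) T)),
        ∫ x : 𝕋³, W t x * (Literature.Analysis.FunctionSpaces.Torus.timeDeriv ψ t ![x 0, x 1] +
          v (x 1) * Literature.Analysis.FunctionSpaces.Torus.partialDeriv 0 (ψ t) ![x 0, x 1]) =
        ∫ y : 𝕋², (∫ s : UnitAddCircle, W t ![y 0, y 1, s]) *
          (Literature.Analysis.FunctionSpaces.Torus.timeDeriv ψ t y +
            v (y 1) * Literature.Analysis.FunctionSpaces.Torus.partialDeriv 0 (ψ t) y) := by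
      filter_upwards [ae_restrict_mem measurableSet_Ioo, hC, hWslice] with t ht hCt hWt
      have hWt2 : MemLp (W t) 2 volume := by
        refine ⟨hWt, ?_⟩
        rw [Literature.Analysis.FunctionSpaces.eLpNorm_two_eq_pow_two_rpow_half,
          Literature.Analysis.FunctionSpaces.eLpNorm_two_pow_two_eq_lintegral]
        exact ENNReal.rpow_lt_top_of_nonneg (by norm_num) (hCt.trans_lt ENNReal.coe_lt_top).ne
      have hGlift : MemLp (fun x : 𝕋³ => Literature.Analysis.FunctionSpaces.Torus.timeDeriv ψ t ![x 0, x 1] +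
          v (x 1) * Literature.Analysis.FunctionSpaces.Torus.partialDeriv 0 (ψ t) ![x 0, x 1]) 2 volume := by
        have h := (hGL t ht).comp_measurePreserving measurePreserving_proj₀₁
        refine h.ae_eq (Eventually.of_forall fun x => ?_)
        simp only [comp_apply, Matrix.cons_val_one, Matrix.cons_val_fin_one]
      have hint : Integrable (fun x : 𝕋³ => (Literature.Analysis.FunctionSpaces.Torus.timeDeriv ψ t ![x 0, x 1] +
          v (x 1) * Literature.Analysis.FunctionSpaces.Torus.partialDeriv 0 (ψ t) ![x 0, x 1]) * W t x) volume :=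
        hGlift.integrable_mul hWt2
      have hint' : Integrable (fun x : 𝕋³ => (fun y : 𝕋² => Literature.Analysis.FunctionSpaces.Torus.timeDeriv ψ t y +
          v (y 1) * Literature.Analysis.FunctionSpaces.Torus.partialDeriv 0 (ψ t) y) ![x 0, x 1] * W t x) volume := by
        refine hint.congr (Eventually.of_forall fun x => ?_)
        simp only [Matrix.cons_val_one, Matrix.cons_val_fin_one]
      have h := integral_planar_mul (f := fun y : 𝕋² => Literature.Analysis.FunctionSpaces.Torus.timeDeriv ψ t y +
          v (y 1) * Literature.Analysis.FunctionSpaces.Torus.partialDeriv 0 (ψ t) y) (G := W t) hint'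
      simp only [Matrix.cons_val_one, Matrix.cons_val_fin_one] at h
      calc ∫ x : 𝕋³, W t x * (Literature.Analysis.FunctionSpaces.Torus.timeDeriv ψ t ![x 0, x 1] +
            v (x 1) * Literature.Analysis.FunctionSpaces.Torus.partialDeriv 0 (ψ t) ![x 0, x 1])
          = ∫ x : 𝕋³, (Literature.Analysis.FunctionSpaces.Torus.timeDeriv ψ t ![x 0, x 1] +
            v (x 1) * Literature.Analysis.FunctionSpaces.Torus.partialDeriv 0 (ψ t) ![x 0, x 1]) * W t x := by
            refine integral_congr_ae (Eventually.of_forall fun x => ?_); ring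
        _ = ∫ y : 𝕋², (Literature.Analysis.FunctionSpaces.Torus.timeDeriv ψ t y +
            v (y 1) * Literature.Analysis.FunctionSpaces.Torus.partialDeriv 0 (ψ t) y) *
              ∫ s : UnitAddCircle, W t ![y 0, y 1, s] := h
        _ = _ := by refine integral_congr_ae (Eventually.of_forall fun y => ?_); ring
    have hdatum : ∫ x : 𝕋³, v₃ ![x 0, x 1] * ψ 0 ![x 0, x 1] = ∫ y : 𝕋², v₃ y * ψ 0 y :=
      integral_planarLift (g := fun y => v₃ y * ψ 0 y) (hv₃.1.mul (hψ.isSmooth_slice 0).continuous.aestronglyMeasurable)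
    rw [integral_congr_ae hdesc, hdatum] at hid
    exact hid

end Descent

/-! ## The weak limit of planar functions is planar -/

section Planar

variable {T : ℝ}

/-- **Lifted fibre averages**: for `F` measurable and square integrable on `(0,T) × T³`, the
planar function `(t,x) ↦ ∫_T F(t,(x₁,x₂,s)) ds` is measurable on `(0,T) × T³`, with slicewise
smaller `L²` norm (Jensen) and finite space–time `L²` norm. [folklore] -/
theorem liftFibreAvg_facts {F : ℝ → 𝕋³ → ℝ}
    (hFm : AEStronglyMeasurable (uncurry F) (((volume : Measure ℝ).restrict (Ioo 0 T)).prod (volume : Measure 𝕋³)))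
    (hFf : ∫⁻ t in Ioo 0 T, ∫⁻ x, ‖F t x‖ₑ ^ 2 < ⊤) :
    AEStronglyMeasurable (uncurry fun t (x : 𝕋³) => ∫ s : UnitAddCircle, F t ![x 0, x 1, s])
        (((volume : Measure ℝ).restrict (Ioo 0 T)).prod (volume : Measure 𝕋³)) ∧
      (∀ᵐ t ∂(volume.restrict (Ioo (0 : ℝ) T)),
        ∫⁻ x : 𝕋³, ‖∫ s : UnitAddCircle, F t ![x 0, x 1, s]‖ₑ ^ 2 ≤ ∫⁻ x, ‖F t x‖ₑ ^ 2) ∧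
      ∫⁻ t in Ioo 0 T, ∫⁻ x : 𝕋³, ‖∫ s : UnitAddCircle, F t ![x 0, x 1, s]‖ₑ ^ 2 < ⊤ := by
  have hw := aestronglyMeasurable_uncurry_fibreAvg ((volume : Measure ℝ).restrict (Ioo 0 T)) hFm
  have hmp : MeasurePreserving (Prod.map id fun x : 𝕋³ => (![x 0, x 1] : 𝕋²))
      (((volume : Measure ℝ).restrict (Ioo 0 T)).prod (volume : Measure 𝕋³))
      (((volume : Measure ℝ).restrict (Ioo 0 T)).prod (volume : Measure 𝕋²)) :=
    (MeasurePreserving.id _).prod measurePreserving_proj₀₁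
  have heq : (uncurry fun t (x : 𝕋³) => ∫ s : UnitAddCircle, F t ![x 0, x 1, s]) =
      (uncurry fun t (y : 𝕋²) => ∫ s : UnitAddCircle, F t ![y 0, y 1, s]) ∘ Prod.map id fun x : 𝕋³ => (![x 0, x 1] : 𝕋²) := by
    funext ⟨t, x⟩; simp
  have hm : AEStronglyMeasurable (uncurry fun t (x : 𝕋³) => ∫ s : UnitAddCircle, F t ![x 0, x 1, s])
      (((volume : Measure ℝ).restrict (Ioo 0 T)).prod (volume : Measure 𝕋³)) := by
    rw [heq]; exact hw.comp_measurePreserving hmp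
  have hslice : ∀ᵐ t ∂(volume.restrict (Ioo (0 : ℝ) T)),
      ∫⁻ x : 𝕋³, ‖∫ s : UnitAddCircle, F t ![x 0, x 1, s]‖ₑ ^ 2 ≤ ∫⁻ x, ‖F t x‖ₑ ^ 2 := by
    have h1 : ∀ᵐ t ∂(volume.restrict (Ioo (0 : ℝ) T)), AEStronglyMeasurable (fun x : 𝕋³ => uncurry F (t, x)) volume :=
      hFm.prodMk_left
    have h2 : ∀ᵐ t ∂(volume.restrict (Ioo (0 : ℝ) T)), AEStronglyMeasurable
        (fun y : 𝕋² => uncurry (fun t (y : 𝕋²) => ∫ s : UnitAddCircle, F t ![y 0, y 1, s]) (t, y)) volume :=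
      hw.prodMk_left
    filter_upwards [h1, h2] with t ht hwt
    have hl := lintegral_planarLift (g := fun y : 𝕋² => ‖∫ s : UnitAddCircle, F t ![y 0, y 1, s]‖ₑ ^ 2)
      (hwt.aemeasurable.enorm.pow_const 2)
    simp only [Matrix.cons_val_zero, Matrix.cons_val_one, Matrix.cons_val_fin_one] at hl
    rw [hl]
    exact lintegral_enorm_sq_fibreAvg_le ht
  refine ⟨hm, hslice, (lintegral_mono_ae hslice).trans_lt hFf⟩

/-- Fibre averages of measurable functions on `T³` are measurable on `T²`. [folklore] -/
theorem aestronglyMeasurable_fibreAvg {G : 𝕋³ → ℝ} (hG : AEStronglyMeasurable G volume) :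
    AEStronglyMeasurable (fun y : 𝕋² => ∫ s : UnitAddCircle, G ![y 0, y 1, s]) volume :=
  (hG.comp_measurePreserving measurePreserving_glue).integral_prod_right'

/-- **Descent–ascent of pairings**: for `f ∈ L²(T²)` lifted and `G ∈ L²(T³)`,
`∫_{T³} f(x₁,x₂) G(x) dx = ∫_{T³} f(x₁,x₂) (∫_T G(x₁,x₂,s) ds) dx`. [folklore] -/
theorem integral_planar_mul_eq_planar_mul_liftAvg {f : 𝕋² → ℝ} {G : 𝕋³ → ℝ} (hf : MemLp f 2 volume)
    (hG : MemLp G 2 volume) :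
    ∫ x : 𝕋³, f ![x 0, x 1] * G x = ∫ x : 𝕋³, f ![x 0, x 1] * ∫ s : UnitAddCircle, G ![x 0, x 1, s] := by
  have hfl : MemLp (fun x : 𝕋³ => f ![x 0, x 1]) 2 volume := hf.comp_measurePreserving measurePreserving_proj₀₁
  rw [integral_planar_mul (hfl.integrable_mul hG)]
  have hm : AEStronglyMeasurable (fun y : 𝕋² => f y * ∫ s : UnitAddCircle, G ![y 0, y 1, s]) volume :=
    hf.1.mul (aestronglyMeasurable_fibreAvg hG.1)
  have h2 := integral_planarLift hm
  simp only [Matrix.cons_val_zero, Matrix.cons_val_one, Matrix.cons_val_fin_one] at h2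
  rw [h2]

/-- Slices of a measurable, square integrable space–time function are in `L²` for a.e. time. [folklore] -/
theorem ae_memLp_two_slice {G : ℝ → 𝕋³ → ℝ}
    (hGm : AEStronglyMeasurable (uncurry G) (((volume : Measure ℝ).restrict (Ioo 0 T)).prod (volume : Measure 𝕋³)))
    (hGf : ∫⁻ t in Ioo 0 T, ∫⁻ x, ‖G t x‖ₑ ^ 2 < ⊤) :
    ∀ᵐ t ∂(volume.restrict (Ioo (0 : ℝ) T)), MemLp (G t) 2 volume := by
  have h1 : ∀ᵐ t ∂(volume.restrict (Ioo (0 : ℝ) T)), AEStronglyMeasurable (fun x : 𝕋³ => uncurry G (t, x)) volume :=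
    hGm.prodMk_left
  have hmeas : AEMeasurable (fun t => ∫⁻ x : 𝕋³, ‖G t x‖ₑ ^ 2) (volume.restrict (Ioo (0 : ℝ) T)) :=
    (hGm.aemeasurable.enorm.pow_const 2).lintegral_prod_right'
  have h2 : ∀ᵐ t ∂(volume.restrict (Ioo (0 : ℝ) T)), ∫⁻ x : 𝕋³, ‖G t x‖ₑ ^ 2 < ⊤ := ae_lt_top' hmeas hGf.ne
  filter_upwards [h1, h2] with t ht hf
  refine ⟨ht, ?_⟩
  rw [Literature.Analysis.FunctionSpaces.eLpNorm_two_eq_pow_two_rpow_half,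
    Literature.Analysis.FunctionSpaces.eLpNorm_two_pow_two_eq_lintegral]
  exact ENNReal.rpow_lt_top_of_nonneg (by norm_num) hf.ne

/-- **The weak `L²((0,T)×T³)` limit of planar functions is planar**: if `c_j(t,(x₁,x₂))`
(square integrable on `(0,T)×T³`) converge weakly to `W` against all measurable square
integrable `G`, then `W(t,·)` coincides a.e. with its own fibre average `∫_T W(t,(x₁,x₂,s))ds`
for a.e. `t ∈ (0,T)`: pairings of planar functions with `G` only see the fibre average of `G`
(`integral_planar_mul_eq_planar_mul_liftAvg`), so `∫∫ W G = ∫∫ W Ḡ = ∫∫ W̄ G`, and one takes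
`G = W - W̄`. [folklore] -/
theorem ae_eq_liftFibreAvg_of_weakLimit {c : ℕ → ℝ → 𝕋² → ℝ}
    (hcL : ∀ j, ∀ᵐ t ∂(volume.restrict (Ioo (0 : ℝ) T)), MemLp (c j t) 2 volume)
    {W : ℝ → 𝕋³ → ℝ}
    (hWm : AEStronglyMeasurable (Literature.Analysis.FunctionSpaces.Torus.stLift W) (volume.restrict (Ioo 0 T ×ˢ univ)))
    (hWb : ∃ C : ℝ≥0, ∀ᵐ t ∂(volume.restrict (Ioo 0 T)), ∫⁻ x, ‖W t x‖ₑ ^ 2 ≤ C)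
    (hweak : ∀ G : ℝ → 𝕋³ → ℝ,
      AEStronglyMeasurable (Literature.Analysis.FunctionSpaces.Torus.stLift G) (volume.restrict (Ioo 0 T ×ˢ univ)) →
      ∫⁻ t in Ioo 0 T, ∫⁻ x, ‖G t x‖ₑ ^ 2 < ⊤ →
      Tendsto (fun j => ∫ t in Ioo 0 T, ∫ x, c j t ![x 0, x 1] * G t x) atTop
        (𝓝 (∫ t in Ioo 0 T, ∫ x, W t x * G t x))) :
    ∀ᵐ t ∂(volume.restrict (Ioo (0 : ℝ) T)), W t =ᵐ[volume] fun x : 𝕋³ => ∫ s : UnitAddCircle, W t ![x 0, x 1, s] := by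
  -- `W` and its lifted fibre average `L` in `L²((0,T)×T³)`
  obtain ⟨Cw, hCw⟩ := hWb
  have hWunc := Literature.Analysis.FunctionSpaces.Torus.aestronglyMeasurable_uncurry_of_stLift_prod hWm
  have hWfin : ∫⁻ t in Ioo 0 T, ∫⁻ x, ‖W t x‖ₑ ^ 2 < ⊤ := by
    refine (lintegral_mono_ae hCw).trans_lt ?_
    rw [lintegral_const, Measure.restrict_apply_univ]
    exact ENNReal.mul_lt_top ENNReal.coe_lt_top measure_Ioo_lt_top
  have hWL : MemLp (uncurry W) 2 (((volume : Measure ℝ).restrict (Ioo 0 T)).prod (volume : Measure 𝕋³)) :=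
    (Literature.Analysis.FunctionSpaces.Torus.memLp_two_uncurry hWunc hWfin).1
  obtain ⟨hLm, hLslice, hLfin⟩ := liftFibreAvg_facts hWunc hWfin
  have hLL : MemLp (uncurry fun t (x : 𝕋³) => ∫ s : UnitAddCircle, W t ![x 0, x 1, s]) 2
      (((volume : Measure ℝ).restrict (Ioo 0 T)).prod (volume : Measure 𝕋³)) :=
    (Literature.Analysis.FunctionSpaces.Torus.memLp_two_uncurry hLm hLfin).1
  have hWslice : ∀ᵐ t ∂(volume.restrict (Ioo (0 : ℝ) T)), MemLp (W t) 2 volume := ae_memLp_two_slice hWunc hWfin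
  have hLslice2 : ∀ᵐ t ∂(volume.restrict (Ioo (0 : ℝ) T)),
      MemLp (fun x : 𝕋³ => ∫ s : UnitAddCircle, W t ![x 0, x 1, s]) 2 volume := ae_memLp_two_slice hLm hLfin
  -- the planar slices `w̄(t) ∈ L²(T²)` for a.e. `t`
  have hwbar : ∀ᵐ t ∂(volume.restrict (Ioo (0 : ℝ) T)),
      MemLp (fun y : 𝕋² => ∫ s : UnitAddCircle, W t ![y 0, y 1, s]) 2 volume := by
    have hw := aestronglyMeasurable_uncurry_fibreAvg ((volume : Measure ℝ).restrict (Ioo 0 T)) hWunc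
    have h1 : ∀ᵐ t ∂(volume.restrict (Ioo (0 : ℝ) T)), AEStronglyMeasurable
        (fun y : 𝕋² => uncurry (fun t (y : 𝕋²) => ∫ s : UnitAddCircle, W t ![y 0, y 1, s]) (t, y)) volume :=
      hw.prodMk_left
    filter_upwards [h1, hWslice, hCw] with t ht hWt hb
    refine ⟨ht, ?_⟩
    rw [Literature.Analysis.FunctionSpaces.eLpNorm_two_eq_pow_two_rpow_half,
      Literature.Analysis.FunctionSpaces.eLpNorm_two_pow_two_eq_lintegral]
    refine ENNReal.rpow_lt_top_of_nonneg (by norm_num) ?_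
    exact (((lintegral_enorm_sq_fibreAvg_le hWt.1).trans hb).trans_lt ENNReal.coe_lt_top).ne
  -- KEY: `∫∫ W G = ∫∫ L G` for every admissible `G`
  have hkey : ∀ G : ℝ → 𝕋³ → ℝ,
      AEStronglyMeasurable (Literature.Analysis.FunctionSpaces.Torus.stLift G) (volume.restrict (Ioo 0 T ×ˢ univ)) →
      ∫⁻ t in Ioo 0 T, ∫⁻ x, ‖G t x‖ₑ ^ 2 < ⊤ →
      ∫ t in Ioo 0 T, ∫ x, W t x * G t x =
        ∫ t in Ioo 0 T, ∫ x : 𝕋³, (∫ s : UnitAddCircle, W t ![x 0, x 1, s]) * G t x := by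
    intro G hGm hGf
    have hGunc := Literature.Analysis.FunctionSpaces.Torus.aestronglyMeasurable_uncurry_of_stLift_prod hGm
    obtain ⟨hAm, hAslice, hAfin⟩ := liftFibreAvg_facts hGunc hGf
    have hGslice : ∀ᵐ t ∂(volume.restrict (Ioo (0 : ℝ) T)), MemLp (G t) 2 volume := ae_memLp_two_slice hGunc hGf
    -- (a) planar functions pair with `G` through the fibre average of `G`
    have hstep1 : ∀ j, ∫ t in Ioo 0 T, ∫ x, c j t ![x 0, x 1] * G t x =
        ∫ t in Ioo 0 T, ∫ x : 𝕋³, c j t ![x 0, x 1] * ∫ s : UnitAddCircle, G t ![x 0, x 1, s] := by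
      intro j
      refine integral_congr_ae ?_
      filter_upwards [hcL j, hGslice] with t hct hGt
      exact integral_planar_mul_eq_planar_mul_liftAvg hct hGt
    -- (b) the lifted fibre average of `G` is admissible, so the weak limits agree
    have hAst : AEStronglyMeasurable (Literature.Analysis.FunctionSpaces.Torus.stLift fun t (x : 𝕋³) =>
        ∫ s : UnitAddCircle, G t ![x 0, x 1, s]) (volume.restrict (Ioo 0 T ×ˢ univ)) :=
      Literature.Analysis.FunctionSpaces.Torus.aestronglyMeasurable_stLift_of_uncurry hAm
    have hlim1 := hweak G hGm hGf
    have hlim2 := hweak _ hAst hAfin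
    simp_rw [hstep1] at hlim1
    have hWeq : ∫ t in Ioo 0 T, ∫ x, W t x * G t x =
        ∫ t in Ioo 0 T, ∫ x : 𝕋³, W t x * ∫ s : UnitAddCircle, G t ![x 0, x 1, s] := tendsto_nhds_unique hlim1 hlim2
    rw [hWeq]
    -- (c) `∫ W Ḡ = ∫ w̄ Ḡ = ∫ L G` slicewise
    have hAslice2 : ∀ᵐ t ∂(volume.restrict (Ioo (0 : ℝ) T)),
        MemLp (fun x : 𝕋³ => ∫ s : UnitAddCircle, G t ![x 0, x 1, s]) 2 volume := ae_memLp_two_slice hAm hAfin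
    refine integral_congr_ae ?_
    filter_upwards [hWslice, hGslice, hwbar, hAslice2] with t hWt hGt hwt hAt
    -- `Ḡ(t)` as a planar function lifted: `x ↦ ḡ(x₁,x₂)` with `ḡ ∈ L²(T²)`
    have hgbar : MemLp (fun y : 𝕋² => ∫ s : UnitAddCircle, G t ![y 0, y 1, s]) 2 volume := by
      refine ⟨aestronglyMeasurable_fibreAvg hGt.1, ?_⟩
      rw [Literature.Analysis.FunctionSpaces.eLpNorm_two_eq_pow_two_rpow_half,
        Literature.Analysis.FunctionSpaces.eLpNorm_two_pow_two_eq_lintegral]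
      refine ENNReal.rpow_lt_top_of_nonneg (by norm_num) ?_
      have h := lintegral_enorm_sq_fibreAvg_le hGt.1
      have hfin : ∫⁻ x, ‖G t x‖ₑ ^ 2 < ⊤ := by
        rw [← Literature.Analysis.FunctionSpaces.eLpNorm_two_pow_two_eq_lintegral]
        exact ENNReal.pow_lt_top hGt.eLpNorm_lt_top
      exact (h.trans_lt hfin).ne
    calc ∫ x : 𝕋³, W t x * ∫ s : UnitAddCircle, G t ![x 0, x 1, s]
        = ∫ x : 𝕋³, (fun y : 𝕋² => ∫ s : UnitAddCircle, G t ![y 0, y 1, s]) ![x 0, x 1] * W t x := by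
          refine integral_congr_ae (Eventually.of_forall fun x => ?_)
          simp only [Matrix.cons_val_zero, Matrix.cons_val_one, Matrix.cons_val_fin_one]; ring
      _ = ∫ x : 𝕋³, (fun y : 𝕋² => ∫ s : UnitAddCircle, G t ![y 0, y 1, s]) ![x 0, x 1] *
            ∫ s : UnitAddCircle, W t ![x 0, x 1, s] := integral_planar_mul_eq_planar_mul_liftAvg hgbar hWt
      _ = ∫ x : 𝕋³, (fun y : 𝕋² => ∫ s : UnitAddCircle, W t ![y 0, y 1, s]) ![x 0, x 1] * G t x := by
          rw [integral_planar_mul_eq_planar_mul_liftAvg hwt hGt]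
          refine integral_congr_ae (Eventually.of_forall fun x => ?_)
          simp only [Matrix.cons_val_zero, Matrix.cons_val_one, Matrix.cons_val_fin_one]; ring
      _ = ∫ x : 𝕋³, (∫ s : UnitAddCircle, W t ![x 0, x 1, s]) * G t x := by
          refine integral_congr_ae (Eventually.of_forall fun x => ?_)
          simp only [Matrix.cons_val_zero, Matrix.cons_val_one, Matrix.cons_val_fin_one]
  -- take `G := W - L`
  have hDm : AEStronglyMeasurable (uncurry fun t (x : 𝕋³) => W t x - ∫ s : UnitAddCircle, W t ![x 0, x 1, s])
      (((volume : Measure ℝ).restrict (Ioo 0 T)).prod (volume : Measure 𝕋³)) := hWunc.sub hLm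
  have hDL : MemLp (uncurry fun t (x : 𝕋³) => W t x - ∫ s : UnitAddCircle, W t ![x 0, x 1, s]) 2
      (((volume : Measure ℝ).restrict (Ioo 0 T)).prod (volume : Measure 𝕋³)) := hWL.sub hLL
  have hDf : ∫⁻ t in Ioo 0 T, ∫⁻ x : 𝕋³, ‖W t x - ∫ s : UnitAddCircle, W t ![x 0, x 1, s]‖ₑ ^ 2 < ⊤ := by
    have h1 : ∫⁻ z, ‖uncurry (fun t (x : 𝕋³) => W t x - ∫ s : UnitAddCircle, W t ![x 0, x 1, s]) z‖ₑ ^ 2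
        ∂(((volume : Measure ℝ).restrict (Ioo 0 T)).prod (volume : Measure 𝕋³)) =
        ∫⁻ t in Ioo 0 T, ∫⁻ x : 𝕋³, ‖W t x - ∫ s : UnitAddCircle, W t ![x 0, x 1, s]‖ₑ ^ 2 :=
      lintegral_prod _ (hDm.aemeasurable.enorm.pow_const 2)
    rw [← h1, ← Literature.Analysis.FunctionSpaces.eLpNorm_two_pow_two_eq_lintegral]
    exact ENNReal.pow_lt_top hDL.eLpNorm_lt_top
  have hDst : AEStronglyMeasurable (Literature.Analysis.FunctionSpaces.Torus.stLift fun t (x : 𝕋³) =>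
      W t x - ∫ s : UnitAddCircle, W t ![x 0, x 1, s]) (volume.restrict (Ioo 0 T ×ˢ univ)) :=
    Literature.Analysis.FunctionSpaces.Torus.aestronglyMeasurable_stLift_of_uncurry hDm
  have hzero : ∫ t in Ioo 0 T, ∫ x : 𝕋³, (W t x - ∫ s : UnitAddCircle, W t ![x 0, x 1, s]) *
      (W t x - ∫ s : UnitAddCircle, W t ![x 0, x 1, s]) = 0 := by
    have h := hkey _ hDst hDf
    have i1 : Integrable (uncurry fun t (x : 𝕋³) => W t x * (W t x - ∫ s : UnitAddCircle, W t ![x 0, x 1, s]))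
        (((volume : Measure ℝ).restrict (Ioo 0 T)).prod (volume : Measure 𝕋³)) := hWL.integrable_mul hDL
    have i2 : Integrable (uncurry fun t (x : 𝕋³) => (∫ s : UnitAddCircle, W t ![x 0, x 1, s]) *
        (W t x - ∫ s : UnitAddCircle, W t ![x 0, x 1, s]))
        (((volume : Measure ℝ).restrict (Ioo 0 T)).prod (volume : Measure 𝕋³)) := hLL.integrable_mul hDL
    have hs : ∫ t in Ioo 0 T, ∫ x : 𝕋³, (W t x - ∫ s : UnitAddCircle, W t ![x 0, x 1, s]) *
        (W t x - ∫ s : UnitAddCircle, W t ![x 0, x 1, s]) =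
        (∫ t in Ioo 0 T, ∫ x : 𝕋³, W t x * (W t x - ∫ s : UnitAddCircle, W t ![x 0, x 1, s])) -
          ∫ t in Ioo 0 T, ∫ x : 𝕋³, (∫ s : UnitAddCircle, W t ![x 0, x 1, s]) *
            (W t x - ∫ s : UnitAddCircle, W t ![x 0, x 1, s]) := by
      rw [← setIntegral_integral_sub₂ i1 i2]
      refine integral_congr_ae (Eventually.of_forall fun t => integral_congr_ae (Eventually.of_forall fun x => ?_))
      ring
    rw [hs, h, sub_self]
  -- conclude: `(W - L)² = 0` a.e. on the product, hence slicewise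
  have hsq_int : Integrable (fun z : ℝ × 𝕋³ => (W z.1 z.2 - ∫ s : UnitAddCircle, W z.1 ![z.2 0, z.2 1, s]) ^ 2)
      (((volume : Measure ℝ).restrict (Ioo 0 T)).prod (volume : Measure 𝕋³)) := by
    have h := hDL.integrable_norm_pow two_ne_zero
    refine h.congr (Eventually.of_forall fun z => ?_)
    simp only [uncurry, Real.norm_eq_abs, sq_abs]
  have hprod0 : ∫ z, (W z.1 z.2 - ∫ s : UnitAddCircle, W z.1 ![z.2 0, z.2 1, s]) ^ 2
      ∂(((volume : Measure ℝ).restrict (Ioo 0 T)).prod (volume : Measure 𝕋³)) = 0 := by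
    rw [integral_prod _ hsq_int]
    simp only
    simp_rw [sq]
    exact hzero
  have hae := (integral_eq_zero_iff_of_nonneg (fun z => sq_nonneg _) hsq_int).1 hprod0
  have hae' : ∀ᵐ z ∂(((volume : Measure ℝ).restrict (Ioo 0 T)).prod (volume : Measure 𝕋³)),
      W z.1 z.2 = ∫ s : UnitAddCircle, W z.1 ![z.2 0, z.2 1, s] := by
    filter_upwards [hae] with z hz
    have := pow_eq_zero_iff two_ne_zero |>.1 hz
    linarith
  exact Measure.ae_ae_of_ae_prod hae'

end Planar

/-! ## Discharge of `BardosTitiWiedemann2012_thm5_limitEq` -/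

section Discharge

/-- A planar function is in `L²(T²)` if its lift is in `L²(T³)` (measurability through the fibre
average of the lift, which is the function itself). [folklore] -/
theorem memLp_planar_of_lift {f : 𝕋² → ℝ} (h : MemLp (fun x : 𝕋³ => f ![x 0, x 1]) 2 volume) : MemLp f 2 volume := by
  have hm : AEStronglyMeasurable f volume := by
    have h1 := aestronglyMeasurable_fibreAvg h.1
    have heq : (fun y : 𝕋² => ∫ s : UnitAddCircle, (fun x : 𝕋³ => f ![x 0, x 1]) ![y 0, y 1, s]) = f := by
      funext y
      simp only [Matrix.cons_val_zero, Matrix.cons_val_one]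
      rw [integral_const, probReal_univ, one_smul, vec2_eta]
    rwa [heq] at h1
  refine ⟨hm, ?_⟩
  rw [Literature.Analysis.FunctionSpaces.eLpNorm_two_eq_pow_two_rpow_half,
    Literature.Analysis.FunctionSpaces.eLpNorm_two_pow_two_eq_lintegral,
    ← lintegral_planarLift (g := fun y : 𝕋² => ‖f y‖ₑ ^ 2) (hm.aemeasurable.enorm.pow_const 2),
    ← Literature.Analysis.FunctionSpaces.eLpNorm_two_pow_two_eq_lintegral,
    ← Literature.Analysis.FunctionSpaces.eLpNorm_two_eq_pow_two_rpow_half]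
  exact h.eLpNorm_lt_top

/-- **Bardos–Titi–Wiedemann 2012, Thm. 5, the limit equation — discharged.** Under the
hypotheses of the named fact `BardosTitiWiedemann2012_thm5_limitEq` (Leray–Hopf solutions of
shear form, viscosities `ν_j → 0`, heat-flow convergence of the first components, weak-* limit
`W` of the third components), `W(t) = v₃(x₁ - t v₁(x₂), x₂)` a.e. for a.e. `t ∈ (0,T)`. Proof:
the limit satisfies the linear transport equation (6) against planar lifts
(`limit_weak_vertical`); `W` is planar (`ae_eq_liftFibreAvg_of_weakLimit`) and its fibre
average is a weak solution on `T²` in `L^∞(0,T;L²)` (`isWeakScalarTransportOn_fibreAvg`), so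
by Lemma 4 (`ae_ae_eq_of_isWeakScalarTransportOn`, `isWeakScalarTransportOn_shearTransport`)
it is the shear transport of `v₃`. [cite: BardosTitiWiedemann2012, Thm. 5, proof; Lemma 4] -/
theorem BardosTitiWiedemann2012_thm5_limitEq_holds : BardosTitiWiedemann2012_thm5_limitEq := by
  intro v₁ hv₁ v₃ hv₃ T hT ν hν hν₀ a c hU W hWm hWb hheat hweak
  -- the limit equation against planar lifts
  have hlim := fun (φ : ℝ → 𝕋² → ℝ) (hφ : Literature.Analysis.FunctionSpaces.Torus.IsSpaceTimeTest T φ) =>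
    limit_weak_vertical hv₁ hv₃ hν hν₀ hU hWm hWb hheat hweak hφ
  -- a measurable representative of `v₁`
  obtain ⟨v', hv's, hvv'⟩ := hv₁.1
  have hv'm : Measurable v' := hv's.measurable
  have hv'2 : MemLp v' 2 volume := hv₁.ae_eq hvv'
  have hV3 : (fun x : 𝕋³ => v₁ (x 1)) =ᵐ[volume] fun x => v' (x 1) :=
    (measurePreserving_eval (fun _ : Fin 3 => (volume : Measure UnitAddCircle)) 1).quasiMeasurePreserving.ae_eq hvv'
  have hlim' : ∀ φ : ℝ → 𝕋² → ℝ, Literature.Analysis.FunctionSpaces.Torus.IsSpaceTimeTest T φ →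
      (∫ t in Ioo 0 T, ∫ x : 𝕋³, W t x * (Literature.Analysis.FunctionSpaces.Torus.timeDeriv φ t ![x 0, x 1] +
          v' (x 1) * Literature.Analysis.FunctionSpaces.Torus.partialDeriv 0 (φ t) ![x 0, x 1])) +
        ∫ x : 𝕋³, v₃ ![x 0, x 1] * φ 0 ![x 0, x 1] = 0 := by
    intro φ hφ
    have h := hlim φ hφ
    have hc : ∀ t, ∫ x : 𝕋³, W t x * (Literature.Analysis.FunctionSpaces.Torus.timeDeriv φ t ![x 0, x 1] +
          v₁ (x 1) * Literature.Analysis.FunctionSpaces.Torus.partialDeriv 0 (φ t) ![x 0, x 1]) =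
        ∫ x : 𝕋³, W t x * (Literature.Analysis.FunctionSpaces.Torus.timeDeriv φ t ![x 0, x 1] +
          v' (x 1) * Literature.Analysis.FunctionSpaces.Torus.partialDeriv 0 (φ t) ![x 0, x 1]) := by
      intro t
      refine integral_congr_ae ?_
      filter_upwards [hV3] with x hx
      rw [hx]
    simp_rw [hc] at h
    exact h
  -- `W` in `L²((0,T)×T³)` and the fibre average as a weak solution on `T²`
  have hWunc := Literature.Analysis.FunctionSpaces.Torus.aestronglyMeasurable_uncurry_of_stLift_prod hWm
  have hstruct := isWeakScalarTransportOn_fibreAvg hv'm hv'2 hv₃ hWunc hWb hlim'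
  have hshear := isWeakScalarTransportOn_shearTransport_of_measurable hv'm hv'2 hv₃ hT
  have huniq := ae_ae_eq_of_isWeakScalarTransportOn hv'2 hT hstruct hshear
  -- `W` is planar
  have hmem : MemLp (shearData v₁ v₃) 2 volume := memLp_shearData hv₁ hv₃
  have hcL : ∀ j, ∀ᵐ t ∂(volume.restrict (Ioo (0 : ℝ) T)), MemLp (c j t) 2 volume := by
    intro j
    filter_upwards [ae_restrict_mem measurableSet_Ioo] with t ht
    have h1 : MemLp (fun x : 𝕋³ => shearField (a j) (c j) t x 2) 2 volume :=
      MemLp.eval_piLp ((hU j).memLp t (Ioo_subset_Icc_self ht)) 2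
    have h2 : MemLp (fun x : 𝕋³ => c j t ![x 0, x 1]) 2 volume := by
      refine h1.ae_eq (Eventually.of_forall fun x => ?_)
      exact (shearField_apply (a j) (c j) t x).2.2
    exact memLp_planar_of_lift h2
  have hplanar := ae_eq_liftFibreAvg_of_weakLimit hcL hWm hWb hweak
  -- combine
  filter_upwards [hplanar, huniq] with t hp hu
  have hq := measurePreserving_proj₀₁.quasiMeasurePreserving.ae_eq hu
  have hq' := measurePreserving_proj₀₁.quasiMeasurePreserving.ae_eq
    ((shear_ae_congr hvv' v₃ t).mono fun y hy => hy.1)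
  filter_upwards [hp, hq, hq'] with x hx hy hz
  simp only [comp_apply, Matrix.cons_val_zero, Matrix.cons_val_one] at hy hz
  rw [hx, hy, ← hz]

end Discharge

end Literature.Barriers.AnomalousDissipation

end
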